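import Mathlib
import Literature.NumberTheory.LFunctions.Zhang2022.Section8FrontEnd44Exact
import Literature.NumberTheory.LFunctions.Zhang2022.Section8FrontEnd44Weights
import Literature.NumberTheory.LFunctions.Zhang2022.Section8FrontEnd44Moments
import Literature.NumberTheory.LFunctions.Zhang2022.Section8FrontEnd44Sizes
import Literature.NumberTheory.LFunctions.Zhang2022.Section8FrontEnd84
import Literature.NumberTheory.LFunctions.Zhang2022.Section8XiZeroTailMean
import Literature.NumberTheory.LFunctions.Zhang2022.Section8Ded823Final
import HarnessLib

/-!
# Zhang (2022) §8 p. 47: the "simple approximation" `Z22:§8.u044` — the deduction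
# `Section8cStatements.DedStep8u044 c′` HOLDS (GAP row G-d20-1 closed in the kernel)

Topic `Literature/NumberTheory/LFunctions/Zhang2022` (Landau–Siegel audit tree; verdict-neutral).
Y. Zhang, *Discrete mean estimates and the Landau–Siegel zero*, arXiv:2211.02515v1 (2022)
[Zhang2022LandauSiegel] — **an unrefereed manuscript under adjudication**; D-0069 campaign, cell
`siegel-zhang`, DISCHARGE lane, front end of `Skeleton.Ded823 c′`, node `Z22:§8.u044` (the display
"Gathering these results together we conclude, by simple approximation, that
`S_j(𝐚₁₁,𝐚₂₁) = L′(1,χ)²Σ_{dr<P₂}(…)(…)(…) + L′(1,χ)²Σ_{P₂≤dr<P₁}(…) + o(α)`", tex L2436–L2442,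
PDF p. 47), typed as the implication `Section8cStatements.DedStep8u044 c′ :
Step8u040 c′ → Step8u041 c′ → Step8u042 c′ → Step8u043 c′ → Step8u044 c′` (slice L2-t8).

**Theorem `dedStep8u044_holds : DedStep8u044 c′`** (every real `c′`). The cell's GAP-LEDGER row
G-d20-1 recorded that the four applications `§8.u040`–`u043` of Lemmas 8.2/8.4 evaluate the inner
sums `M_k, N_k` of `S_j(𝐚₁₁,𝐚₂₁)` only for `dr < P_k/T`, while the display sums over all `dr < P_k`;
on the tail ranges `P_k/T ≤ dr < P_k` an additional in-paper estimate is needed, isolated as the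
WANTED declaration `XiZeroMajorant.xiZeroTailMean` (`Σ_{n<x}|ξ₀ⱼ(n;d,r)|/n ≪ 𝓛(1 + log x)³`,
`x ≤ T`), since PROVED in the tree (`Section8XiZeroTailMean`, seat d37). This file performs the
reduction announced in that row, in the kernel:

* the exact identity `Section8FrontEnd44Exact.Sj_a11_a21_eq`:
  `S_j = Σ_{n<P₂}Σ_{dr=n} w_j(d,r)(M₁+ι₂M₂)(N₁+ῑ₂N₂) + Σ_{P₂≤n<P₁}Σ_{dr=n} w_j(d,r)M₁N₁`, and the
  matching identity for the display (`target_eq`: its right side is the same double sum with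
  `M_k, N_k` replaced by the main terms `A_k = L′(1,χ)𝓕_{jμ}(P_k/dr)/log P_k`,
  `B_k = L′(1,χ)Π(d,r)𝓖_{jμ}(P_k/dr)/log P_k`);
* four ranges of `n = dr`: `[1, P₂/T)` (all four approximations, errors `C₁𝓛⁻¹⁵`),
  `[P₂/T, P₂)` (`M₁, N₁` approximated; `M₂, N₂` and `A₂, B₂` bounded trivially:
  `|M₂| ≤ 8(log T)²/𝓛⁹`, `|N₂| ≤ 32C₂(log T)⁴/𝓛⁸` by `xiZeroTailMean`), `[P₂, P₁/T)`, `[P₁/T, P₁)`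
  (pointwise lemmas `pointwise_I`–`pointwise_IV`, sizes from `Section8FrontEnd44Sizes`:
  `|A_k| ≤ σ`, `|B_k| ≤ σ|Π(d,r)|`, `σ = S/𝓛⁷`, `|L′(1,χ)| ≤ 4e^{9/2}𝓛²`);
* the weights: `Σ_{dr=n}|w_j(d,r)|(1 + |Π(d,r)|) ≤ 2n⁻¹∏_{q∣n}(1+106/q)`
  (`Section8FrontEnd44Weights.weight_antidiagonal_le`) and the multiplicative-interval moments
  `Σ_{Y≤n<Z} n⁻¹∏_{q∣n}(1+106/q) ≤ e¹⁰⁶(1 + log(Z/Y))` (`Section8FrontEnd44Moments`), giving the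
  range totals `≪ 𝓛⁻¹³`, `≪ (log T)⁷𝓛⁻¹⁷ = 𝓛^{-9.3}`, `≪ 𝓛⁻¹³`, `≪ 𝓛^{-9.3}` (`range_sum_le`,
  `scales`), hence `= o(α)` (`α = π𝓛⁻⁹`; `final_small`: `K(log T)⁷ ≤ επ𝓛⁸` once
  `𝓛 ≥ K¹⁰/(επ)¹⁰`, via `(log T)¹⁰ = 𝓛¹¹`).

| DAG node | typed claim | theorem | status |
|---|---|---|---|
| `Z22:§8.u044` (deduction) | `Section8cStatements.DedStep8u044 c′` | `dedStep8u044_holds` | DISCHARGED |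

WHAT THIS FILE IS NOT: a proof of Lemmas 8.2/8.4 or of Proposition 7.1; nothing here bears on the
manuscript's Theorems 1–2 or on Landau–Siegel zeros. Theorem-only; no definition, no new fact.

## References

* Y. Zhang, arXiv:2211.02515v1 (2022), §8 p. 47 (tex L2420–L2442), Lemmas 8.2–8.4, (8.6), (8.8);
  (2.21), (2.22), (2.26). [cite: Zhang2022LandauSiegel, §8 p.47]
-/

noncomputable section

open Complex Real ComplexConjugate Finset

namespace Literature.NumberTheory.LFunctions.Zhang2022.Section8FrontEnd44Reduction

open Literature.NumberTheory.LFunctions.Zhang2022.Skeleton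
open Literature.NumberTheory.LFunctions.Zhang2022.Section8FrontEnd82
open Literature.NumberTheory.LFunctions.Zhang2022.Section8FrontEnd84
open Literature.NumberTheory.LFunctions.Zhang2022.Section8FrontEnd44Sizes

/-! ## Parameters for large `D` -/

/-- For `D ≥ ⌈e³⌉`, `𝓛 = log D ≥ 3`. [cite: Zhang2022LandauSiegel, §2 (2.1) p.4] -/
theorem three_le_ell {D : ℕ} (hD : ⌈Real.exp 3⌉₊ ≤ D) : 3 ≤ ell D := by
  have hexp : Real.exp 3 ≤ D := le_trans (Nat.le_ceil _) (by exact_mod_cast hD)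
  exact (Real.le_log_iff_exp_le (lt_of_lt_of_le (Real.exp_pos _) hexp)).mpr hexp

/-- For `D ≥ ⌈e³⌉`, `D ≥ 3`. [cite: Zhang2022LandauSiegel, §2 (2.1) p.4] -/
theorem three_le_of_ceil {D : ℕ} (hD : ⌈Real.exp 3⌉₊ ≤ D) : 3 ≤ D := by
  have h3 : (3 : ℝ) ≤ Real.exp 3 := by linarith [Real.add_one_le_exp (3 : ℝ)]
  have hexp : Real.exp 3 ≤ D := le_trans (Nat.le_ceil _) (by exact_mod_cast hD)
  exact_mod_cast h3.trans hexp

/-- More comparisons between `T = e^{𝓛^{1.1}}`, `P₁ = P^{0.504}`, `P₂ = P^{0.5}T^{−10}` for `𝓛 ≥ 2`: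
`T ≤ P₂`, `P₂T ≤ P₁`, `log T = 𝓛^{1.1}`, `𝓛 ≤ 𝓛^{1.1}`, `1 < T`.
[cite: Zhang2022LandauSiegel, §2 (2.6), (2.21) p.10; §6 p.30] -/
theorem params2 {D : ℕ} (hL : 2 ≤ ell D) :
    bigT D ≤ Skeleton.P2 D ∧ Skeleton.P2 D * bigT D ≤ Skeleton.P1 D ∧
      Real.log (bigT D) = ell D ^ (1.1 : ℝ) ∧ ell D ≤ ell D ^ (1.1 : ℝ) ∧ 1 < bigT D := by
  set L := ell D with hLdef
  have hL1 : (1 : ℝ) ≤ L := by linarith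
  have h11 : L ^ (1.1 : ℝ) ≤ L ^ 2 := by
    rw [← Real.rpow_two]
    exact Real.rpow_le_rpow_of_exponent_le hL1 (by norm_num)
  have h1 : L ≤ L ^ (1.1 : ℝ) := by
    calc L = L ^ (1 : ℝ) := (Real.rpow_one L).symm
      _ ≤ L ^ (1.1 : ℝ) := Real.rpow_le_rpow_of_exponent_le hL1 (by norm_num)
  have h11' : 0 ≤ L ^ (1.1 : ℝ) := by positivity
  have hL7 : (128 : ℝ) ≤ L ^ 7 := by
    calc (128 : ℝ) = 2 ^ 7 := by norm_num
      _ ≤ L ^ 7 := by gcongr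
  have hL9 : L ^ 9 = L ^ 2 * L ^ 7 := by ring
  have hL2 : 0 ≤ L ^ 2 := by positivity
  have h2 : 128 * L ^ 2 ≤ L ^ 9 := by rw [hL9]; nlinarith
  have hT : bigT D = Real.exp (L ^ (1.1 : ℝ)) := by rw [bigT, hLdef]
  have hP1 : Skeleton.P1 D = Real.exp (0.504 * L ^ 9) := by
    rw [Skeleton.P1, bigP, ← hLdef, ← Real.exp_mul, mul_comm]
  have hP2 : Skeleton.P2 D = Real.exp (0.5 * L ^ 9 - 10 * L ^ (1.1 : ℝ)) := by
    rw [Skeleton.P2, bigP, ← hLdef, ← Real.exp_mul, hT, ← Real.exp_nat_mul, ← Real.exp_sub]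
    norm_num [mul_comm]
  refine ⟨?_, ?_, ?_, h1, ?_⟩
  · rw [hT, hP2, Real.exp_le_exp]; nlinarith
  · rw [hP2, hT, hP1, ← Real.exp_add, Real.exp_le_exp]; nlinarith
  · rw [hT, Real.log_exp]
  · rw [hT]; exact Real.one_lt_exp_iff.mpr (by positivity)

/-! ## The four pointwise bookkeeping lemmas (one per range of `n = dr`) -/

/-- Range `dr < P₂/T` (all four inner sums approximated with error `δ`; main terms of size
`|A_k| ≤ σ`, `|B_k| ≤ σ|Π|`): `|(M₁+ιM₂)(N₁+ῑN₂) − (A₁+ιA₂)(B₁+ῑB₂)| ≤ 18δσ(1+|Π|)`.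
[cite: Zhang2022LandauSiegel, §8 p.47, tex L2436] -/
theorem pointwise_I {ι M₁ M₂ N₁ N₂ A₁ A₂ B₁ B₂ : ℂ} {δ σ Pn : ℝ} (hι : ‖ι‖ ≤ 2)
    (hM₁ : ‖M₁ - A₁‖ ≤ δ) (hM₂ : ‖M₂ - A₂‖ ≤ δ) (hN₁ : ‖N₁ - B₁‖ ≤ δ) (hN₂ : ‖N₂ - B₂‖ ≤ δ)
    (hA₁ : ‖A₁‖ ≤ σ) (hA₂ : ‖A₂‖ ≤ σ) (hB₁ : ‖B₁‖ ≤ σ * Pn) (hB₂ : ‖B₂‖ ≤ σ * Pn)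
    (hPn : 0 ≤ Pn) (hδσ : δ ≤ σ) :
    ‖(M₁ + ι * M₂) * (N₁ + conj ι * N₂) - (A₁ + ι * A₂) * (B₁ + conj ι * B₂)‖ ≤
      18 * δ * σ * (1 + Pn) := by
  have hδ : 0 ≤ δ := le_trans (norm_nonneg _) hM₁
  have hσ : 0 ≤ σ := hδ.trans hδσ
  have h := norm_mul_mul_sub_le hι hM₁ hM₂ hN₁ hN₂ hA₁ hA₂ hB₁ hB₂
  refine h.trans ?_
  nlinarith [mul_nonneg (mul_nonneg hδ hσ) hPn, mul_nonneg hδ (sub_nonneg.mpr hδσ)]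

/-- Range `P₂/T ≤ dr < P₂` (`M₁, N₁` approximated with error `δ`; `|M₂| ≤ m`, `|N₂| ≤ ν`;
`|A_k| ≤ σ`, `|B_k| ≤ σ|Π|`): the product differs from its main term by at most
`(27σ² + 12σν + 12mσ + 4mν)(1+|Π|)`. [cite: Zhang2022LandauSiegel, §8 p.47, tex L2436] -/
theorem pointwise_II {ι M₁ M₂ N₁ N₂ A₁ A₂ B₁ B₂ : ℂ} {δ σ m ν Pn : ℝ} (hι : ‖ι‖ ≤ 2)
    (hM₁ : ‖M₁ - A₁‖ ≤ δ) (hN₁ : ‖N₁ - B₁‖ ≤ δ) (hM₂ : ‖M₂‖ ≤ m) (hN₂ : ‖N₂‖ ≤ ν)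
    (hA₁ : ‖A₁‖ ≤ σ) (hA₂ : ‖A₂‖ ≤ σ) (hB₁ : ‖B₁‖ ≤ σ * Pn) (hB₂ : ‖B₂‖ ≤ σ * Pn)
    (hPn : 0 ≤ Pn) (hδσ : δ ≤ σ) :
    ‖(M₁ + ι * M₂) * (N₁ + conj ι * N₂) - (A₁ + ι * A₂) * (B₁ + conj ι * B₂)‖ ≤
      (27 * σ ^ 2 + 12 * σ * ν + 12 * m * σ + 4 * m * ν) * (1 + Pn) := by
  have hδ : 0 ≤ δ := le_trans (norm_nonneg _) hM₁
  have hm : 0 ≤ m := le_trans (norm_nonneg _) hM₂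
  have hν : 0 ≤ ν := le_trans (norm_nonneg _) hN₂
  have hσ : 0 ≤ σ := hδ.trans hδσ
  have hsd : 0 ≤ σ - δ := sub_nonneg.mpr hδσ
  have hM₂' : ‖M₂ - A₂‖ ≤ m + σ := (norm_sub_le _ _).trans (add_le_add hM₂ hA₂)
  have hN₂' : ‖N₂ - B₂‖ ≤ ν + σ * Pn := (norm_sub_le _ _).trans (add_le_add hN₂ hB₂)
  have h := norm_mul_mul_sub_le hι hM₁ hM₂' hN₁ hN₂' hA₁ hA₂ hB₁ hB₂
  refine h.trans ?_
  nlinarith [mul_nonneg hδ hsd, mul_nonneg hσ hsd, mul_nonneg hσ hσ, mul_nonneg hν hsd,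
    mul_nonneg hm hsd, mul_nonneg hm hσ, mul_nonneg hσ hν, mul_nonneg hm hν,
    mul_nonneg (mul_nonneg hσ hsd) hPn, mul_nonneg (mul_nonneg hσ hσ) hPn,
    mul_nonneg (mul_nonneg hm hσ) hPn, mul_nonneg (mul_nonneg hσ hν) hPn,
    mul_nonneg (mul_nonneg hm hν) hPn, mul_nonneg (mul_nonneg hδ hσ) hPn]

/-- Range `P₂ ≤ dr < P₁/T` (two-factor form; `M₁, N₁` approximated):
`|M₁N₁ − A₁B₁| ≤ 2δσ(1+|Π|)`. [cite: Zhang2022LandauSiegel, §8 p.47, tex L2436] -/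
theorem pointwise_III {M₁ N₁ A₁ B₁ : ℂ} {δ σ Pn : ℝ} (hM₁ : ‖M₁ - A₁‖ ≤ δ) (hN₁ : ‖N₁ - B₁‖ ≤ δ)
    (hA₁ : ‖A₁‖ ≤ σ) (hB₁ : ‖B₁‖ ≤ σ * Pn) (hPn : 0 ≤ Pn) (hδσ : δ ≤ σ) :
    ‖M₁ * N₁ - A₁ * B₁‖ ≤ 2 * δ * σ * (1 + Pn) := by
  have hδ : 0 ≤ δ := le_trans (norm_nonneg _) hM₁
  have hσ : 0 ≤ σ := hδ.trans hδσ
  have h := norm_mul_sub_le M₁ N₁ A₁ B₁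
  calc ‖M₁ * N₁ - A₁ * B₁‖
      ≤ ‖M₁ - A₁‖ * (‖B₁‖ + ‖N₁ - B₁‖) + ‖A₁‖ * ‖N₁ - B₁‖ := h
    _ ≤ δ * (σ * Pn + δ) + σ * δ :=
        add_le_add (mul_le_mul hM₁ (add_le_add hB₁ hN₁) (by positivity) hδ)
          (mul_le_mul hA₁ hN₁ (norm_nonneg _) hσ)
    _ ≤ 2 * δ * σ * (1 + Pn) := by
        nlinarith [mul_nonneg (mul_nonneg hδ hσ) hPn, mul_nonneg hδ (sub_nonneg.mpr hδσ)]

/-- Range `P₁/T ≤ dr < P₁` (two-factor form, trivial bounds `|M₁| ≤ m`, `|N₁| ≤ ν`):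
`|M₁N₁ − A₁B₁| ≤ (mν + σ²)(1+|Π|)`. [cite: Zhang2022LandauSiegel, §8 p.47, tex L2436] -/
theorem pointwise_IV {M₁ N₁ A₁ B₁ : ℂ} {m ν σ Pn : ℝ} (hM₁ : ‖M₁‖ ≤ m) (hN₁ : ‖N₁‖ ≤ ν)
    (hA₁ : ‖A₁‖ ≤ σ) (hB₁ : ‖B₁‖ ≤ σ * Pn) (hPn : 0 ≤ Pn) :
    ‖M₁ * N₁ - A₁ * B₁‖ ≤ (m * ν + σ ^ 2) * (1 + Pn) := by
  have hm : 0 ≤ m := le_trans (norm_nonneg _) hM₁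
  have hν : 0 ≤ ν := le_trans (norm_nonneg _) hN₁
  have hσ : 0 ≤ σ := le_trans (norm_nonneg _) hA₁
  calc ‖M₁ * N₁ - A₁ * B₁‖ ≤ ‖M₁ * N₁‖ + ‖A₁ * B₁‖ := norm_sub_le _ _
    _ = ‖M₁‖ * ‖N₁‖ + ‖A₁‖ * ‖B₁‖ := by rw [norm_mul, norm_mul]
    _ ≤ m * ν + σ * (σ * Pn) :=
        add_le_add (mul_le_mul hM₁ hN₁ (norm_nonneg _) hm) (mul_le_mul hA₁ hB₁ (norm_nonneg _) hσ)
    _ ≤ (m * ν + σ ^ 2) * (1 + Pn) := by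
        nlinarith [mul_nonneg (mul_nonneg hm hν) hPn, mul_nonneg hσ hσ]

/-! ## The inner sums on the tail ranges -/

/-- `(β₆).re = 0`, `(β₇).re = 0` (purely imaginary shifts, `α ≥ 0`).
[cite: Zhang2022LandauSiegel, §2 (2.22) p.10] -/
theorem beta6_re_beta7_re {D : ℕ} (hα : 0 ≤ alpha D) : (beta6 D).re = 0 ∧ (beta7 D).re = 0 := by
  have h6 := (betaMu_facts hα 6).1
  have h7 := (betaMu_facts hα 7).1
  have e6 : betaMu D 6 = beta6 D := by simp [betaMu]
  have e7 : betaMu D 7 = beta7 D := by simp [betaMu]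
  exact ⟨e6 ▸ h6, e7 ▸ h7⟩

/-- Trivial bound for the `m`-sum `M₁` of `S_j(𝐚₁₁,𝐚₂₁)` at `dr = k < P₁`:
`|M₁| ≤ (log x/log P₁)(1 + log x)`, `x = P₁/k` ((8.6)). [cite: Zhang2022LandauSiegel, §8 (8.6) p.45] -/
theorem norm_M1_le (c' : ℝ) {D : ℕ} [NeZero D] (χ : DirichletCharacter ℂ D) (hL : 2 ≤ ell D)
    (j : ℕ) {k : ℕ} (hk : 1 ≤ k) (hkP : (k : ℝ) < Skeleton.P1 D) :
    ‖∑ m ∈ Finset.Ico 1 (Nsupp D), χ (m : ZMod D) * vk1 D (k * m) / (m : ℂ) ^ (1 - betaJ c' D j)‖ ≤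
      Real.log (Skeleton.P1 D / k) / Real.log (Skeleton.P1 D) * (1 + Real.log (Skeleton.P1 D / k)) := by
  obtain ⟨-, -, hP1PT, -, -, -, -, -⟩ := params hL
  have hk1 : (1 : ℝ) ≤ k := by exact_mod_cast hk
  have hk0 : (0 : ℝ) < k := by linarith
  have hP1one : 1 < Skeleton.P1 D := lt_of_le_of_lt hk1 hkP
  have hP1pos : 0 < Skeleton.P1 D := by linarith
  have hα : 0 ≤ alpha D := by rw [Section2.alpha_eq_pi_div_ell9]; positivity
  have hβ : (beta6 D).re = 0 := (beta6_re_beta7_re hα).1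
  have hs : (1 - betaJ c' D j).re = 1 := XiZeroMajorant.one_sub_betaJ_re c' D j
  have hN : ⌈Skeleton.P1 D / k⌉₊ ≤ Nsupp D := by
    show ⌈Skeleton.P1 D / k⌉₊ ≤ ⌈bigP D / bigT D ^ 2⌉₊
    exact Nat.ceil_mono (le_trans (div_le_self hP1pos.le hk1) hP1PT)
  have hx1 : 1 ≤ Skeleton.P1 D / k := (one_le_div hk0).mpr hkP.le
  exact norm_msum_tail_le χ (V := vk1 D) hP1one hk hβ hs
    (fun m hm hkm => vk1_mul_eq hP1one hk hm hkm) (fun m h => vk1_mul_eq_zero h) hN hx1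

/-- Trivial bound for the `m`-sum `M₂` at `dr = k < P₂`: `|M₂| ≤ (log x/log P₂)(1 + log x)`,
`x = P₂/k`. [cite: Zhang2022LandauSiegel, §8 (8.6) p.45] -/
theorem norm_M2_le (c' : ℝ) {D : ℕ} [NeZero D] (χ : DirichletCharacter ℂ D) (hL : 2 ≤ ell D)
    (j : ℕ) {k : ℕ} (hk : 1 ≤ k) (hkP : (k : ℝ) < Skeleton.P2 D) :
    ‖∑ m ∈ Finset.Ico 1 (Nsupp D), χ (m : ZMod D) * vk2 D (k * m) / (m : ℂ) ^ (1 - betaJ c' D j)‖ ≤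
      Real.log (Skeleton.P2 D / k) / Real.log (Skeleton.P2 D) * (1 + Real.log (Skeleton.P2 D / k)) := by
  obtain ⟨-, -, -, hP2PT, -, -, -, -⟩ := params hL
  have hk1 : (1 : ℝ) ≤ k := by exact_mod_cast hk
  have hk0 : (0 : ℝ) < k := by linarith
  have hP2one : 1 < Skeleton.P2 D := lt_of_le_of_lt hk1 hkP
  have hP2pos : 0 < Skeleton.P2 D := by linarith
  have hα : 0 ≤ alpha D := by rw [Section2.alpha_eq_pi_div_ell9]; positivity
  have hβ : (beta7 D).re = 0 := (beta6_re_beta7_re hα).2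
  have hs : (1 - betaJ c' D j).re = 1 := XiZeroMajorant.one_sub_betaJ_re c' D j
  have hN : ⌈Skeleton.P2 D / k⌉₊ ≤ Nsupp D := by
    show ⌈Skeleton.P2 D / k⌉₊ ≤ ⌈bigP D / bigT D ^ 2⌉₊
    exact Nat.ceil_mono (le_trans (div_le_self hP2pos.le hk1) hP2PT)
  have hx1 : 1 ≤ Skeleton.P2 D / k := (one_le_div hk0).mpr hkP.le
  exact norm_msum_tail_le χ (V := vk2 D) hP2one hk hβ hs
    (fun m hm hkm => vk2_mul_eq hP2one hk hm hkm) (fun m h => vk2_mul_eq_zero h) hN hx1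

/-- Trivial bound for the `n`-sum `N₁` of `S_j(𝐚₁₁,𝐚₂₁)` at `dr = k < P₁`:
`|N₁| ≤ (log x/log P₁)·Σ_{n<x}|ξ₀ⱼ(n;d,r)|/n`, `x = P₁/k` ((8.6), `|(x/n)^{−β₆}| = 1`).
[cite: Zhang2022LandauSiegel, §8 (8.6) p.45] -/
theorem norm_N1_le (c' : ℝ) {D : ℕ} [NeZero D] (χ : DirichletCharacter ℂ D) (hL : 2 ≤ ell D)
    (j d r : ℕ) {k : ℕ} (hk : 1 ≤ k) (hkP : (k : ℝ) < Skeleton.P1 D) :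
    ‖∑ n ∈ Finset.Ico 1 (Nsupp D),
        χ (n : ZMod D) * conj (vk1 D (k * n)) * xiZero c' D j n d r / (n : ℂ)‖ ≤
      Real.log (Skeleton.P1 D / k) / Real.log (Skeleton.P1 D) *
        ∑ n ∈ Finset.Ico 1 ⌈Skeleton.P1 D / k⌉₊, ‖xiZero c' D j n d r‖ / n := by
  obtain ⟨-, -, hP1PT, -, -, -, -, -⟩ := params hL
  have hk1 : (1 : ℝ) ≤ k := by exact_mod_cast hk
  have hk0 : (0 : ℝ) < k := by linarith
  have hP1one : 1 < Skeleton.P1 D := lt_of_le_of_lt hk1 hkP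
  have hP1pos : 0 < Skeleton.P1 D := by linarith
  have hα : 0 ≤ alpha D := by rw [Section2.alpha_eq_pi_div_ell9]; positivity
  have hβ : (-beta6 D).re = 0 := by rw [Complex.neg_re, (beta6_re_beta7_re hα).1, neg_zero]
  have hN : ⌈Skeleton.P1 D / k⌉₊ ≤ Nsupp D := by
    show ⌈Skeleton.P1 D / k⌉₊ ≤ ⌈bigP D / bigT D ^ 2⌉₊
    exact Nat.ceil_mono (le_trans (div_le_self hP1pos.le hk1) hP1PT)
  have hx1 : 1 ≤ Skeleton.P1 D / k := (one_le_div hk0).mpr hkP.le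
  exact norm_nsum_tail_le χ (W := fun i => conj (vk1 D i)) (fun n => xiZero c' D j n d r)
    hP1one hk hβ (fun n hn hkn => conj_vk1_mul_eq hP1one hk hn hkn)
    (fun n h => by simp only [vk1_mul_eq_zero h, map_zero]) hN hx1

/-- Trivial bound for the `n`-sum `N₂` at `dr = k < P₂`:
`|N₂| ≤ (log x/log P₂)·Σ_{n<x}|ξ₀ⱼ(n;d,r)|/n`, `x = P₂/k`. [cite: Zhang2022LandauSiegel, §8 (8.6) p.45] -/
theorem norm_N2_le (c' : ℝ) {D : ℕ} [NeZero D] (χ : DirichletCharacter ℂ D) (hL : 2 ≤ ell D)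
    (j d r : ℕ) {k : ℕ} (hk : 1 ≤ k) (hkP : (k : ℝ) < Skeleton.P2 D) :
    ‖∑ n ∈ Finset.Ico 1 (Nsupp D),
        χ (n : ZMod D) * conj (vk2 D (k * n)) * xiZero c' D j n d r / (n : ℂ)‖ ≤
      Real.log (Skeleton.P2 D / k) / Real.log (Skeleton.P2 D) *
        ∑ n ∈ Finset.Ico 1 ⌈Skeleton.P2 D / k⌉₊, ‖xiZero c' D j n d r‖ / n := by
  obtain ⟨-, -, -, hP2PT, -, -, -, -⟩ := params hL
  have hk1 : (1 : ℝ) ≤ k := by exact_mod_cast hk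
  have hk0 : (0 : ℝ) < k := by linarith
  have hP2one : 1 < Skeleton.P2 D := lt_of_le_of_lt hk1 hkP
  have hP2pos : 0 < Skeleton.P2 D := by linarith
  have hα : 0 ≤ alpha D := by rw [Section2.alpha_eq_pi_div_ell9]; positivity
  have hβ : (-beta7 D).re = 0 := by rw [Complex.neg_re, (beta6_re_beta7_re hα).2, neg_zero]
  have hN : ⌈Skeleton.P2 D / k⌉₊ ≤ Nsupp D := by
    show ⌈Skeleton.P2 D / k⌉₊ ≤ ⌈bigP D / bigT D ^ 2⌉₊
    exact Nat.ceil_mono (le_trans (div_le_self hP2pos.le hk1) hP2PT)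
  have hx1 : 1 ≤ Skeleton.P2 D / k := (one_le_div hk0).mpr hkP.le
  exact norm_nsum_tail_le χ (W := fun i => conj (vk2 D i)) (fun n => xiZero c' D j n d r)
    hP2one hk hβ (fun n hn hkn => conj_vk2_mul_eq hP2one hk hn hkn)
    (fun n h => by simp only [vk2_mul_eq_zero h, map_zero]) hN hx1

/-! ## The weighted sum over a range of `n = dr` -/

/-- **Range total.** If on `⌈Y⌉ ≤ n < ⌈Z⌉` (`1 ≤ Y ≤ Z`) every factorisation `n = dr` carries an
error `|Φ(d,r)| ≤ E(1 + |Π(d,r)|)`, then the weighted total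
`Σ_n Σ_{dr=n} |w_j(d,r)|·|Φ(d,r)|` (`w_j(d,r) = |μ(r)||χ(dr)|λ₀ⱼ(dr)/(drφ(r))`, the weight of
`S_j(𝐚₁₁,𝐚₂₁)`) is at most `2e¹⁰⁶·E·(1 + log(Z/Y))` — by `weight_antidiagonal_le` and the
multiplicative-interval moment bound. [cite: Zhang2022LandauSiegel, §8 p.47, tex L2436] -/
theorem range_sum_le (c' : ℝ) {D : ℕ} [NeZero D] (χ : DirichletCharacter ℂ D) (j : ℕ)
    {Y Z E : ℝ} (hY : 1 ≤ Y) (hYZ : Y ≤ Z) (hE : 0 ≤ E) (Φ : ℕ × ℕ → ℂ)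
    (hΦ : ∀ n ∈ Finset.Ico ⌈Y⌉₊ ⌈Z⌉₊, ∀ p ∈ Nat.divisorsAntidiagonal n,
      ‖Φ p‖ ≤ E * (1 + ‖PiW χ p.1 p.2‖)) :
    ∑ n ∈ Finset.Ico ⌈Y⌉₊ ⌈Z⌉₊, ∑ p ∈ Nat.divisorsAntidiagonal n,
        ‖((ArithmeticFunction.moebius p.2).natAbs : ℂ) * (‖χ ((p.1 * p.2 : ℕ) : ZMod D)‖ : ℂ) /
              (((p.1 * p.2 : ℕ) : ℂ) * (Nat.totient p.2 : ℂ)) * lamZero c' D j (p.1 * p.2)‖ * ‖Φ p‖ ≤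
      2 * Real.exp 106 * E * (1 + Real.log (Z / Y)) := by
  have hY0 : 0 < Y := by linarith
  have hinner : ∀ n ∈ Finset.Ico ⌈Y⌉₊ ⌈Z⌉₊, ∑ p ∈ Nat.divisorsAntidiagonal n,
      ‖((ArithmeticFunction.moebius p.2).natAbs : ℂ) * (‖χ ((p.1 * p.2 : ℕ) : ZMod D)‖ : ℂ) /
            (((p.1 * p.2 : ℕ) : ℂ) * (Nat.totient p.2 : ℂ)) * lamZero c' D j (p.1 * p.2)‖ * ‖Φ p‖ ≤
        (∏ q ∈ n.primeFactors, (1 + 106 / (q : ℝ))) / (n : ℝ) * (2 * E) := by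
    intro n hn
    have hn1 : 1 ≤ n :=
      (Nat.one_le_iff_ne_zero.mpr (Nat.ceil_pos.mpr hY0).ne').trans (Finset.mem_Ico.mp hn).1
    have hn0 : n ≠ 0 := by omega
    have hnR : (0 : ℝ) < n := by exact_mod_cast hn1
    have hterm : ∀ p ∈ Nat.divisorsAntidiagonal n,
        ‖((ArithmeticFunction.moebius p.2).natAbs : ℂ) * (‖χ ((p.1 * p.2 : ℕ) : ZMod D)‖ : ℂ) /
              (((p.1 * p.2 : ℕ) : ℂ) * (Nat.totient p.2 : ℂ)) * lamZero c' D j (p.1 * p.2)‖ * ‖Φ p‖ ≤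
          E * (((ArithmeticFunction.moebius p.2).natAbs : ℝ) * ‖lamZero c' D j n‖ *
            (1 + ‖PiW χ p.1 p.2‖) / ((n : ℝ) * Nat.totient p.2)) := by
      intro p hp
      have hΦp := hΦ n hn p hp
      obtain ⟨hpn, -⟩ := Nat.mem_divisorsAntidiagonal.mp hp
      have hp2 : 1 ≤ p.2 := Nat.one_le_iff_ne_zero.mpr fun h => hn0 (by rw [← hpn, h, mul_zero])
      have hφ : (0 : ℝ) < Nat.totient p.2 := by exact_mod_cast Nat.totient_pos.mpr hp2
      rw [hpn]
      have hw : ‖((ArithmeticFunction.moebius p.2).natAbs : ℂ) * (‖χ (n : ZMod D)‖ : ℂ) /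
            ((n : ℂ) * (Nat.totient p.2 : ℂ)) * lamZero c' D j n‖ ≤
          ((ArithmeticFunction.moebius p.2).natAbs : ℝ) / ((n : ℝ) * Nat.totient p.2) *
            ‖lamZero c' D j n‖ := by
        rw [norm_mul, norm_div, norm_mul, norm_mul, Complex.norm_natCast, Complex.norm_real,
          Real.norm_of_nonneg (norm_nonneg _), Complex.norm_natCast, Complex.norm_natCast]
        apply mul_le_mul_of_nonneg_right _ (norm_nonneg _)
        apply div_le_div_of_nonneg_right _ (by positivity)
        exact mul_le_of_le_one_right (by positivity) (DirichletCharacter.norm_le_one χ _)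
      calc ‖((ArithmeticFunction.moebius p.2).natAbs : ℂ) * (‖χ (n : ZMod D)‖ : ℂ) /
              ((n : ℂ) * (Nat.totient p.2 : ℂ)) * lamZero c' D j n‖ * ‖Φ p‖
          ≤ (((ArithmeticFunction.moebius p.2).natAbs : ℝ) / ((n : ℝ) * Nat.totient p.2) *
              ‖lamZero c' D j n‖) * (E * (1 + ‖PiW χ p.1 p.2‖)) :=
            mul_le_mul hw hΦp (norm_nonneg _) (by positivity)
        _ = E * (((ArithmeticFunction.moebius p.2).natAbs : ℝ) * ‖lamZero c' D j n‖ *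
              (1 + ‖PiW χ p.1 p.2‖) / ((n : ℝ) * Nat.totient p.2)) := by ring
    calc ∑ p ∈ Nat.divisorsAntidiagonal n,
          ‖((ArithmeticFunction.moebius p.2).natAbs : ℂ) * (‖χ ((p.1 * p.2 : ℕ) : ZMod D)‖ : ℂ) /
                (((p.1 * p.2 : ℕ) : ℂ) * (Nat.totient p.2 : ℂ)) * lamZero c' D j (p.1 * p.2)‖ * ‖Φ p‖
        ≤ ∑ p ∈ Nat.divisorsAntidiagonal n,
            E * (((ArithmeticFunction.moebius p.2).natAbs : ℝ) * ‖lamZero c' D j n‖ *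
              (1 + ‖PiW χ p.1 p.2‖) / ((n : ℝ) * Nat.totient p.2)) := Finset.sum_le_sum hterm
      _ = E * ∑ p ∈ Nat.divisorsAntidiagonal n,
            ((ArithmeticFunction.moebius p.2).natAbs : ℝ) * ‖lamZero c' D j n‖ *
              (1 + ‖PiW χ p.1 p.2‖) / ((n : ℝ) * Nat.totient p.2) := by rw [Finset.mul_sum]
      _ ≤ E * (2 * (∏ q ∈ n.primeFactors, (1 + 106 / (q : ℝ))) / n) :=
          mul_le_mul_of_nonneg_left (Section8FrontEnd44Weights.weight_antidiagonal_le c' χ j hn0) hE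
      _ = (∏ q ∈ n.primeFactors, (1 + 106 / (q : ℝ))) / (n : ℝ) * (2 * E) := by ring
  calc ∑ n ∈ Finset.Ico ⌈Y⌉₊ ⌈Z⌉₊, ∑ p ∈ Nat.divisorsAntidiagonal n,
        ‖((ArithmeticFunction.moebius p.2).natAbs : ℂ) * (‖χ ((p.1 * p.2 : ℕ) : ZMod D)‖ : ℂ) /
              (((p.1 * p.2 : ℕ) : ℂ) * (Nat.totient p.2 : ℂ)) * lamZero c' D j (p.1 * p.2)‖ * ‖Φ p‖
      ≤ ∑ n ∈ Finset.Ico ⌈Y⌉₊ ⌈Z⌉₊, (∏ q ∈ n.primeFactors, (1 + 106 / (q : ℝ))) / (n : ℝ) * (2 * E) :=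
        Finset.sum_le_sum hinner
    _ ≤ Real.exp 106 * (2 * E) * (1 + Real.log (Z / Y)) :=
        Section8FrontEnd44Moments.sum_Ico_prod_one_add_div_mul_le (c := 106) (by norm_num) hY hYZ
          (g := fun _ => 2 * E) (G := 2 * E) (fun _ => by positivity) (fun _ _ => le_rfl)
    _ = 2 * Real.exp 106 * E * (1 + Real.log (Z / Y)) := by ring

/-! ## Scales -/

/-- The monomial comparisons behind the range totals (`1 ≤ 𝓛 ≤ τ = log T`): everything is
`≤ const·τ⁷/𝓛¹⁷`. [cite: Zhang2022LandauSiegel, §8 p.47, tex L2436] -/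
theorem scales {L τ S C₁ C₂ : ℝ} (hL : 1 ≤ L) (hτ : L ≤ τ) (hS : 0 ≤ S) (hC₁ : 0 ≤ C₁)
    (hC₂ : 0 ≤ C₂) :
    C₁ / L ^ 15 * (S / L ^ 7) * (2 * L ^ 9) ≤ 2 * C₁ * S * (τ ^ 7 / L ^ 17) ∧
    (S / L ^ 7) ^ 2 * τ ≤ S ^ 2 * (τ ^ 7 / L ^ 17) ∧
    S / L ^ 7 * (32 * C₂ * τ ^ 4 / L ^ 8) * τ ≤ 32 * S * C₂ * (τ ^ 7 / L ^ 17) ∧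
    8 * τ ^ 2 / L ^ 9 * (S / L ^ 7) * τ ≤ 8 * S * (τ ^ 7 / L ^ 17) ∧
    8 * τ ^ 2 / L ^ 9 * (32 * C₂ * τ ^ 4 / L ^ 8) * τ = 256 * C₂ * (τ ^ 7 / L ^ 17) := by
  have hτ1 : 1 ≤ τ := hL.trans hτ
  have hL0 : 0 < L := by linarith
  have hτ0 : 0 < τ := by linarith
  have hL' : L ≠ 0 := hL0.ne'
  have m1 : 1 / L ^ 13 ≤ τ ^ 7 / L ^ 17 := by
    rw [div_le_div_iff₀ (by positivity) (by positivity)]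
    calc 1 * L ^ 17 = L ^ 4 * L ^ 13 := by ring
      _ ≤ τ ^ 4 * L ^ 13 := by gcongr
      _ ≤ τ ^ 7 * L ^ 13 :=
          mul_le_mul_of_nonneg_right (pow_le_pow_right₀ hτ1 (by norm_num)) (by positivity)
  have m2 : τ / L ^ 14 ≤ τ ^ 7 / L ^ 17 := by
    rw [div_le_div_iff₀ (by positivity) (by positivity)]
    calc τ * L ^ 17 = τ * L ^ 3 * L ^ 14 := by ring
      _ ≤ τ * τ ^ 3 * L ^ 14 := by gcongr
      _ = τ ^ 4 * L ^ 14 := by ring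
      _ ≤ τ ^ 7 * L ^ 14 :=
          mul_le_mul_of_nonneg_right (pow_le_pow_right₀ hτ1 (by norm_num)) (by positivity)
  have m3 : τ ^ 5 / L ^ 15 ≤ τ ^ 7 / L ^ 17 := by
    rw [div_le_div_iff₀ (by positivity) (by positivity)]
    calc τ ^ 5 * L ^ 17 = τ ^ 5 * L ^ 2 * L ^ 15 := by ring
      _ ≤ τ ^ 5 * τ ^ 2 * L ^ 15 := by gcongr
      _ = τ ^ 7 * L ^ 15 := by ring
  have m4 : τ ^ 3 / L ^ 16 ≤ τ ^ 7 / L ^ 17 := by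
    rw [div_le_div_iff₀ (by positivity) (by positivity)]
    calc τ ^ 3 * L ^ 17 = τ ^ 3 * L * L ^ 16 := by ring
      _ ≤ τ ^ 3 * τ * L ^ 16 := by gcongr
      _ = τ ^ 4 * L ^ 16 := by ring
      _ ≤ τ ^ 7 * L ^ 16 :=
          mul_le_mul_of_nonneg_right (pow_le_pow_right₀ hτ1 (by norm_num)) (by positivity)
  refine ⟨?_, ?_, ?_, ?_, ?_⟩
  · have e : C₁ / L ^ 15 * (S / L ^ 7) * (2 * L ^ 9) = 2 * C₁ * S * (1 / L ^ 13) := by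
      field_simp
    rw [e]; exact mul_le_mul_of_nonneg_left m1 (by positivity)
  · have e : (S / L ^ 7) ^ 2 * τ = S ^ 2 * (τ / L ^ 14) := by field_simp
    rw [e]; exact mul_le_mul_of_nonneg_left m2 (by positivity)
  · have e : S / L ^ 7 * (32 * C₂ * τ ^ 4 / L ^ 8) * τ = 32 * S * C₂ * (τ ^ 5 / L ^ 15) := by
      field_simp
    rw [e]; exact mul_le_mul_of_nonneg_left m3 (by positivity)
  · have e : 8 * τ ^ 2 / L ^ 9 * (S / L ^ 7) * τ = 8 * S * (τ ^ 3 / L ^ 16) := by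
      field_simp
    rw [e]; exact mul_le_mul_of_nonneg_left m4 (by positivity)
  · field_simp; ring

/-- **The final smallness**: for `e > 0`, `𝓛 ≥ max(1, K¹⁰/e¹⁰)`:
`K(𝓛^{1.1})⁷/𝓛¹⁷ ≤ e/𝓛⁹` (via `(𝓛^{1.1})¹⁰ = 𝓛¹¹` and tenth powers). With `e = επ` this is
`K(log T)⁷𝓛⁻¹⁷ ≤ εα`. [cite: Zhang2022LandauSiegel, §2 (2.6) p.5; §8 p.47] -/
theorem final_small {K e L : ℝ} (he : 0 < e) (hL1 : 1 ≤ L)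
    (hLK : K ^ 10 / e ^ 10 ≤ L) :
    K * (L ^ (1.1 : ℝ)) ^ 7 / L ^ 17 ≤ e / L ^ 9 := by
  have hL0 : 0 < L := by linarith
  set τ := L ^ (1.1 : ℝ) with hτ
  have hτ0 : 0 ≤ τ := by positivity
  have hτ10 : τ ^ 10 = L ^ 11 := by
    have h := Real.rpow_mul_natCast hL0.le (1.1 : ℝ) 10
    rw [show (1.1 : ℝ) * ((10 : ℕ) : ℝ) = ((11 : ℕ) : ℝ) by norm_num, Real.rpow_natCast] at h
    rw [hτ, ← h]
  have key : K * τ ^ 7 ≤ e * L ^ 8 := by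
    apply le_of_pow_le_pow_left₀ (by norm_num : (10 : ℕ) ≠ 0) (by positivity)
    have h1 : (K * τ ^ 7) ^ 10 = K ^ 10 * L ^ 77 := by
      rw [mul_pow, ← pow_mul, show 7 * 10 = 10 * 7 by norm_num, pow_mul, hτ10, ← pow_mul]
    have h2 : (e * L ^ 8) ^ 10 = e ^ 10 * L ^ 3 * L ^ 77 := by ring
    rw [h1, h2]
    have hKe : K ^ 10 ≤ e ^ 10 * L ^ 3 := by
      have h3 : K ^ 10 ≤ L * e ^ 10 := (div_le_iff₀ (by positivity)).mp hLK
      have hL3 : L ≤ L ^ 3 := by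
        calc L = L ^ 1 := (pow_one L).symm
          _ ≤ L ^ 3 := pow_le_pow_right₀ hL1 (by norm_num)
      calc K ^ 10 ≤ L * e ^ 10 := h3
        _ ≤ L ^ 3 * e ^ 10 := mul_le_mul_of_nonneg_right hL3 (by positivity)
        _ = e ^ 10 * L ^ 3 := by ring
    exact mul_le_mul_of_nonneg_right hKe (by positivity)
  rw [div_le_div_iff₀ (by positivity) (by positivity)]
  calc K * τ ^ 7 * L ^ 9 ≤ e * L ^ 8 * L ^ 9 := mul_le_mul_of_nonneg_right key (by positivity)
    _ = e * L ^ 17 := by ring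

/-! ## The reduction, for fixed `D`, `χ`, `j` -/

set_option maxHeartbeats 400000 in
/-- **Core estimate of the "simple approximation" `Z22:§8.u044`.** For constants `C₁, C₂ ≥ 0` there
is `K = K(c′, C₁, C₂)` such that: for every `D ≥ ⌈e³⌉`, real primitive `χ (mod D)` and `j`, if the
four applications `§8.u040`–`u043` hold at this `D, χ, j` with error `C₁𝓛⁻¹⁵` (ranges `dr < P_k/T`)
and the tail mean `Σ_{n<x}|ξ₀ⱼ(n;d,r)|/n ≤ C₂𝓛(1 + log x)³` (`x ≤ T`) holds, then `S_j(𝐚₁₁,𝐚₂₁)`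
differs from the right side of the gathering display by at most `K(log T)⁷𝓛⁻¹⁷`
(`log T = 𝓛^{1.1}`, so this is `K𝓛^{-9.3} = o(α)`). [cite: Zhang2022LandauSiegel, §8 p.47, tex L2436] -/
theorem core (c' : ℝ) {C₁ C₂ : ℝ} (hC₁ : 0 ≤ C₁) (hC₂ : 0 ≤ C₂) :
    ∃ K : ℝ, 0 ≤ K ∧ ∀ {D : ℕ} [NeZero D] {χ : DirichletCharacter ℂ D}, χ.IsQuadratic →
      χ.IsPrimitive → ⌈Real.exp 3⌉₊ ≤ D → ∀ j : ℕ,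
      (∀ d r : ℕ, 1 ≤ d → 1 ≤ r → ((d * r : ℕ) : ℝ) < Skeleton.P1 D / bigT D →
        ‖(∑ m ∈ Finset.Ico 1 (Nsupp D),
              χ (m : ZMod D) * vk1 D (d * r * m) / (m : ℂ) ^ (1 - betaJ c' D j)) -
            deriv χ.LFunction 1 / (Real.log (Skeleton.P1 D) : ℂ) *
              frakfW c' D j 6 (Skeleton.P1 D / ((d * r : ℕ) : ℝ))‖ ≤ C₁ / ell D ^ 15) →
      (∀ d r : ℕ, 1 ≤ d → 1 ≤ r → ((d * r : ℕ) : ℝ) < Skeleton.P2 D / bigT D →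
        ‖(∑ m ∈ Finset.Ico 1 (Nsupp D),
              χ (m : ZMod D) * vk2 D (d * r * m) / (m : ℂ) ^ (1 - betaJ c' D j)) -
            deriv χ.LFunction 1 / (Real.log (Skeleton.P2 D) : ℂ) *
              frakfW c' D j 7 (Skeleton.P2 D / ((d * r : ℕ) : ℝ))‖ ≤ C₁ / ell D ^ 15) →
      (∀ d r : ℕ, 1 ≤ d → 1 ≤ r → ((d * r : ℕ) : ℝ) < Skeleton.P1 D / bigT D →
        ‖(∑ n ∈ Finset.Ico 1 (Nsupp D),
              χ (n : ZMod D) * conj (vk1 D (d * r * n)) * xiZero c' D j n d r / (n : ℂ)) -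
            deriv χ.LFunction 1 * PiW χ d r / (Real.log (Skeleton.P1 D) : ℂ) *
              frakgW c' D j 6 (Skeleton.P1 D / ((d * r : ℕ) : ℝ))‖ ≤ C₁ / ell D ^ 15) →
      (∀ d r : ℕ, 1 ≤ d → 1 ≤ r → ((d * r : ℕ) : ℝ) < Skeleton.P2 D / bigT D →
        ‖(∑ n ∈ Finset.Ico 1 (Nsupp D),
              χ (n : ZMod D) * conj (vk2 D (d * r * n)) * xiZero c' D j n d r / (n : ℂ)) -
            deriv χ.LFunction 1 * PiW χ d r / (Real.log (Skeleton.P2 D) : ℂ) *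
              frakgW c' D j 7 (Skeleton.P2 D / ((d * r : ℕ) : ℝ))‖ ≤ C₁ / ell D ^ 15) →
      (∀ d r : ℕ, 1 ≤ d → 1 ≤ r → ((d * r : ℕ) : ℝ) < Skeleton.P1 D → ∀ x : ℝ, 1 ≤ x →
        x ≤ bigT D → ∑ n ∈ Finset.Ico 1 ⌈x⌉₊, ‖xiZero c' D j n d r‖ / n ≤
          C₂ * ell D * (1 + Real.log x) ^ 3) →
      ‖Sj c' D j (a11 χ) (a21 χ) -
          (deriv χ.LFunction 1 ^ 2 *
              (∑ n ∈ Finset.Ico 1 ⌈Skeleton.P2 D⌉₊, ∑ p ∈ Nat.divisorsAntidiagonal n,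
                Section8cStatements.arithW c' χ j p.1 p.2 *
                  (Section8cStatements.mFac c' D j n * Section8cStatements.nFac c' D j n)) +
            deriv χ.LFunction 1 ^ 2 *
              (∑ n ∈ Finset.Ico ⌈Skeleton.P2 D⌉₊ ⌈Skeleton.P1 D⌉₊, ∑ p ∈ Nat.divisorsAntidiagonal n,
                Section8cStatements.arithW c' χ j p.1 p.2 * Section8cStatements.diagFac c' D j n))‖ ≤
        K * (ell D ^ (1.1 : ℝ)) ^ 7 / ell D ^ 17 := by
  obtain ⟨F₀, hF₀⟩ : ∃ F₀ : ℝ, F₀ = 1 + (5.5 + 60 * |c'|) * π := ⟨_, rfl⟩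
  obtain ⟨G₀, hG₀⟩ : ∃ G₀ : ℝ, G₀ = 1 + 8 * (1 + 20 * |c'|) ^ 2 + (5.5 + 60 * |c'|) ^ 2 * π :=
    ⟨_, rfl⟩
  have hF₀0 : 0 ≤ F₀ := by rw [hF₀]; positivity
  have hG₀0 : 0 ≤ G₀ := by rw [hG₀]; positivity
  obtain ⟨S, hS⟩ : ∃ S : ℝ, S = 16 * Real.exp (9 / 2) * (F₀ + G₀) + C₁ + 1 := ⟨_, rfl⟩
  have hS0 : 0 ≤ S := by rw [hS]; positivity
  have hC₁S : C₁ ≤ S := by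
    rw [hS]; have : 0 ≤ 16 * Real.exp (9 / 2) * (F₀ + G₀) := by positivity
    linarith
  refine ⟨Real.exp 106 * (80 * C₁ * S + 112 * S ^ 2 + 1536 * S * C₂ + 384 * S + 5120 * C₂),
    by positivity, ?_⟩
  intro D _ χ hq hχ hD3 j h40 h41 h42 h43 hξ
  -- parameters
  have hL3 : 3 ≤ ell D := three_le_ell hD3
  have hD3' : 3 ≤ D := three_le_of_ceil hD3
  have hL2 : 2 ≤ ell D := by linarith
  have hL1 : 1 ≤ ell D := by linarith
  have hL0 : 0 < ell D := by linarith
  obtain ⟨hlogP1, hlogP2, hP1PT, -, -, -, hP1P, hP2P⟩ := params hL2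
  obtain ⟨hTP2, hP2TP1, hlogT, hLτ, hT1⟩ := params2 hL2
  have hL' : ‖deriv χ.LFunction 1‖ ≤ 4 * Real.exp (9 / 2) * ell D ^ 2 :=
    norm_deriv_LFunction_one_le χ hχ hL3
  have hι : ‖iota2‖ ≤ 2 := norm_iota2_le_two
  set τ : ℝ := ell D ^ (1.1 : ℝ) with hτdef
  have hτ1 : 1 ≤ τ := hL1.trans hLτ
  have hτ0 : 0 < τ := by linarith
  have hT0 : 0 < bigT D := by linarith
  have hP2pos : 0 < Skeleton.P2 D := by linarith
  have hP2one : 1 < Skeleton.P2 D := lt_of_lt_of_le hT1 hTP2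
  have hP1pos : 0 < Skeleton.P1 D := lt_of_lt_of_le (mul_pos hP2pos hT0) hP2TP1
  have hP2P1T : Skeleton.P2 D ≤ Skeleton.P1 D / bigT D := (le_div_iff₀ hT0).mpr hP2TP1
  have hP1TP1 : Skeleton.P1 D / bigT D ≤ Skeleton.P1 D := div_le_self hP1pos.le hT1.le
  have hP2TP2 : Skeleton.P2 D / bigT D ≤ Skeleton.P2 D := div_le_self hP2pos.le hT1.le
  have hP2T1 : 1 ≤ Skeleton.P2 D / bigT D := (one_le_div hT0).mpr hTP2
  have hP2P1 : Skeleton.P2 D ≤ Skeleton.P1 D := hP2P1T.trans hP1TP1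
  have hlogP1' : ell D ^ 9 / 4 ≤ Real.log (Skeleton.P1 D) := by
    rw [hlogP1]; nlinarith [pow_pos hL0 9]
  have hlogP1pos : 0 < Real.log (Skeleton.P1 D) := lt_of_lt_of_le (by positivity) hlogP1'
  have hlogP2pos : 0 < Real.log (Skeleton.P2 D) := lt_of_lt_of_le (by positivity) hlogP2
  have hlogP : Real.log (bigP D) = ell D ^ 9 := by rw [bigP, Real.log_exp]
  -- scales
  have hsc := scales (L := ell D) (τ := τ) (S := S) hL1 hLτ hS0 hC₁ hC₂
  set δ : ℝ := C₁ / ell D ^ 15 with hδ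
  set σ : ℝ := S / ell D ^ 7 with hσ
  set m : ℝ := 8 * τ ^ 2 / ell D ^ 9 with hm
  set ν : ℝ := 32 * C₂ * τ ^ 4 / ell D ^ 8 with hν
  rw [mul_div_assoc]
  set u : ℝ := τ ^ 7 / ell D ^ 17 with hu
  obtain ⟨s1, s2, s3, s4, s5⟩ := hsc
  have hδ0 : 0 ≤ δ := by rw [hδ]; positivity
  have hσ0 : 0 ≤ σ := by rw [hσ]; positivity
  have hm0 : 0 ≤ m := by rw [hm]; positivity
  have hν0 : 0 ≤ ν := by rw [hν]; positivity
  have hu0 : 0 ≤ u := by rw [hu]; positivity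
  have hδσ : δ ≤ σ := by
    rw [hδ, hσ]
    exact div_le_div₀ hS0 hC₁S (by positivity) (pow_le_pow_right₀ hL1 (by norm_num))
  have hδσ0 : 0 ≤ δ * σ := mul_nonneg hδ0 hσ0
  have hσν0 : 0 ≤ σ * ν := mul_nonneg hσ0 hν0
  have hmσ0 : 0 ≤ m * σ := mul_nonneg hm0 hσ0
  have hmν0 : 0 ≤ m * ν := mul_nonneg hm0 hν0
  have hσσ0 : 0 ≤ σ ^ 2 := sq_nonneg σ
  have hEI0 : 0 ≤ 18 * δ * σ := by linarith
  have hEII0 : 0 ≤ 27 * σ ^ 2 + 12 * σ * ν + 12 * m * σ + 4 * m * ν := by linarith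
  have hEIII0 : 0 ≤ 2 * δ * σ := by linarith
  have hEIV0 : 0 ≤ m * ν + σ ^ 2 := by linarith
  have he106 : 0 ≤ 2 * Real.exp 106 := by positivity
  have hσF : 4 * Real.exp (9 / 2) * ell D ^ 2 * F₀ / (ell D ^ 9 / 4) ≤ σ := by
    rw [hσ, div_le_div_iff₀ (by positivity) (by positivity)]
    have hrest : 0 ≤ (16 * Real.exp (9 / 2) * G₀ + C₁ + 1) * ell D ^ 9 := by positivity
    calc 4 * Real.exp (9 / 2) * ell D ^ 2 * F₀ * ell D ^ 7
        = (16 * Real.exp (9 / 2) * F₀) * ell D ^ 9 / 4 := by ring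
      _ ≤ ((16 * Real.exp (9 / 2) * F₀) * ell D ^ 9 +
            (16 * Real.exp (9 / 2) * G₀ + C₁ + 1) * ell D ^ 9) / 4 := by linarith
      _ = S * (ell D ^ 9 / 4) := by rw [hS]; ring
  have hσG : 4 * Real.exp (9 / 2) * ell D ^ 2 * G₀ / (ell D ^ 9 / 4) ≤ σ := by
    rw [hσ, div_le_div_iff₀ (by positivity) (by positivity)]
    have hrest : 0 ≤ (16 * Real.exp (9 / 2) * F₀ + C₁ + 1) * ell D ^ 9 := by positivity
    calc 4 * Real.exp (9 / 2) * ell D ^ 2 * G₀ * ell D ^ 7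
        = (16 * Real.exp (9 / 2) * G₀) * ell D ^ 9 / 4 := by ring
      _ ≤ ((16 * Real.exp (9 / 2) * G₀) * ell D ^ 9 +
            (16 * Real.exp (9 / 2) * F₀ + C₁ + 1) * ell D ^ 9) / 4 := by linarith
      _ = S * (ell D ^ 9 / 4) := by rw [hS]; ring
  -- the main-term sizes, abstractly
  have hAk : ∀ {Q y : ℝ} (μ : ℕ), ell D ^ 9 / 4 ≤ Real.log Q → 1 ≤ y → y ≤ bigP D →
      ‖deriv χ.LFunction 1 / (Real.log Q : ℂ) * frakfW c' D j μ y‖ ≤ σ := by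
    intro Q y μ hℓQ hy1 hyP
    have hlogQ : 0 < Real.log Q := lt_of_lt_of_le (by positivity) hℓQ
    have hf : ‖frakfW c' D j μ y‖ ≤ F₀ := by rw [hF₀]; exact norm_frakfW_le c' hD3' j μ hy1 hyP
    rw [norm_mul, norm_div, Complex.norm_real, Real.norm_of_nonneg hlogQ.le]
    calc ‖deriv χ.LFunction 1‖ / Real.log Q * ‖frakfW c' D j μ y‖
        ≤ 4 * Real.exp (9 / 2) * ell D ^ 2 / (ell D ^ 9 / 4) * F₀ :=
          mul_le_mul (div_le_div₀ (by positivity) hL' (by positivity) hℓQ) hf (norm_nonneg _)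
            (by positivity)
      _ = 4 * Real.exp (9 / 2) * ell D ^ 2 * F₀ / (ell D ^ 9 / 4) := by ring
      _ ≤ σ := hσF
  have hBk : ∀ {Q y : ℝ} (μ d r : ℕ), ell D ^ 9 / 4 ≤ Real.log Q → 1 ≤ y → y ≤ bigP D →
      ‖deriv χ.LFunction 1 * PiW χ d r / (Real.log Q : ℂ) * frakgW c' D j μ y‖ ≤
        σ * ‖PiW χ d r‖ := by
    intro Q y μ d r hℓQ hy1 hyP
    have hlogQ : 0 < Real.log Q := lt_of_lt_of_le (by positivity) hℓQ
    have hg : ‖frakgW c' D j μ y‖ ≤ G₀ := by rw [hG₀]; exact norm_frakgW_le c' hD3' j μ hy1 hyP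
    rw [norm_mul, norm_div, norm_mul, Complex.norm_real, Real.norm_of_nonneg hlogQ.le]
    calc ‖deriv χ.LFunction 1‖ * ‖PiW χ d r‖ / Real.log Q * ‖frakgW c' D j μ y‖
        = ‖deriv χ.LFunction 1‖ / Real.log Q * ‖frakgW c' D j μ y‖ * ‖PiW χ d r‖ := by ring
      _ ≤ 4 * Real.exp (9 / 2) * ell D ^ 2 / (ell D ^ 9 / 4) * G₀ * ‖PiW χ d r‖ :=
          mul_le_mul_of_nonneg_right
            (mul_le_mul (div_le_div₀ (by positivity) hL' (by positivity) hℓQ) hg (norm_nonneg _)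
              (by positivity)) (norm_nonneg _)
      _ = 4 * Real.exp (9 / 2) * ell D ^ 2 * G₀ / (ell D ^ 9 / 4) * ‖PiW χ d r‖ := by ring
      _ ≤ σ * ‖PiW χ d r‖ := mul_le_mul_of_nonneg_right hσG (norm_nonneg _)
  -- the objects
  set M₁ : ℕ × ℕ → ℂ := fun p => ∑ m ∈ Finset.Ico 1 (Nsupp D),
    χ (m : ZMod D) * vk1 D (p.1 * p.2 * m) / (m : ℂ) ^ (1 - betaJ c' D j) with hM₁
  set M₂ : ℕ × ℕ → ℂ := fun p => ∑ m ∈ Finset.Ico 1 (Nsupp D),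
    χ (m : ZMod D) * vk2 D (p.1 * p.2 * m) / (m : ℂ) ^ (1 - betaJ c' D j) with hM₂
  set N₁ : ℕ × ℕ → ℂ := fun p => ∑ n ∈ Finset.Ico 1 (Nsupp D),
    χ (n : ZMod D) * conj (vk1 D (p.1 * p.2 * n)) * xiZero c' D j n p.1 p.2 / (n : ℂ) with hN₁
  set N₂ : ℕ × ℕ → ℂ := fun p => ∑ n ∈ Finset.Ico 1 (Nsupp D),
    χ (n : ZMod D) * conj (vk2 D (p.1 * p.2 * n)) * xiZero c' D j n p.1 p.2 / (n : ℂ) with hN₂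
  set A₁ : ℕ × ℕ → ℂ := fun p => deriv χ.LFunction 1 / (Real.log (Skeleton.P1 D) : ℂ) *
    frakfW c' D j 6 (Skeleton.P1 D / ((p.1 * p.2 : ℕ) : ℝ)) with hA₁
  set A₂ : ℕ × ℕ → ℂ := fun p => deriv χ.LFunction 1 / (Real.log (Skeleton.P2 D) : ℂ) *
    frakfW c' D j 7 (Skeleton.P2 D / ((p.1 * p.2 : ℕ) : ℝ)) with hA₂
  set B₁ : ℕ × ℕ → ℂ := fun p => deriv χ.LFunction 1 * PiW χ p.1 p.2 /
    (Real.log (Skeleton.P1 D) : ℂ) * frakgW c' D j 6 (Skeleton.P1 D / ((p.1 * p.2 : ℕ) : ℝ)) with hB₁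
  set B₂ : ℕ × ℕ → ℂ := fun p => deriv χ.LFunction 1 * PiW χ p.1 p.2 /
    (Real.log (Skeleton.P2 D) : ℂ) * frakgW c' D j 7 (Skeleton.P2 D / ((p.1 * p.2 : ℕ) : ℝ)) with hB₂
  set w : ℕ × ℕ → ℂ := fun p => ((ArithmeticFunction.moebius p.2).natAbs : ℂ) *
    (‖χ ((p.1 * p.2 : ℕ) : ZMod D)‖ : ℂ) / (((p.1 * p.2 : ℕ) : ℂ) * (Nat.totient p.2 : ℂ)) *
    lamZero c' D j (p.1 * p.2) with hw
  -- Step 1: the exact form of `S_j`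
  have hSj : Sj c' D j (a11 χ) (a21 χ) =
      (∑ n ∈ Finset.Ico 1 ⌈Skeleton.P2 D⌉₊, ∑ p ∈ Nat.divisorsAntidiagonal n,
          w p * ((M₁ p + iota2 * M₂ p) * (N₁ p + conj iota2 * N₂ p))) +
        ∑ n ∈ Finset.Ico ⌈Skeleton.P2 D⌉₊ ⌈Skeleton.P1 D⌉₊, ∑ p ∈ Nat.divisorsAntidiagonal n,
          w p * (M₁ p * N₁ p) := by
    rw [Section8FrontEnd44Exact.Sj_a11_a21_eq c' hq hP1PT hP2P1 j]
  -- Step 2: the display's right side in the same form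
  have hTgt : deriv χ.LFunction 1 ^ 2 *
        (∑ n ∈ Finset.Ico 1 ⌈Skeleton.P2 D⌉₊, ∑ p ∈ Nat.divisorsAntidiagonal n,
          Section8cStatements.arithW c' χ j p.1 p.2 *
            (Section8cStatements.mFac c' D j n * Section8cStatements.nFac c' D j n)) +
      deriv χ.LFunction 1 ^ 2 *
        (∑ n ∈ Finset.Ico ⌈Skeleton.P2 D⌉₊ ⌈Skeleton.P1 D⌉₊, ∑ p ∈ Nat.divisorsAntidiagonal n,
          Section8cStatements.arithW c' χ j p.1 p.2 * Section8cStatements.diagFac c' D j n) =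
      (∑ n ∈ Finset.Ico 1 ⌈Skeleton.P2 D⌉₊, ∑ p ∈ Nat.divisorsAntidiagonal n,
          w p * ((A₁ p + iota2 * A₂ p) * (B₁ p + conj iota2 * B₂ p))) +
        ∑ n ∈ Finset.Ico ⌈Skeleton.P2 D⌉₊ ⌈Skeleton.P1 D⌉₊, ∑ p ∈ Nat.divisorsAntidiagonal n,
          w p * (A₁ p * B₁ p) := by
    congr 1
    · rw [Finset.mul_sum]
      refine Finset.sum_congr rfl fun n _ => ?_
      rw [Finset.mul_sum]
      refine Finset.sum_congr rfl fun p hp => ?_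
      obtain ⟨hpn, -⟩ := Nat.mem_divisorsAntidiagonal.mp hp
      simp only [hw, hA₁, hA₂, hB₁, hB₂, Section8cStatements.arithW, Section8cStatements.mFac,
        Section8cStatements.nFac]
      rw [← hpn]
      ring
    · rw [Finset.mul_sum]
      refine Finset.sum_congr rfl fun n _ => ?_
      rw [Finset.mul_sum]
      refine Finset.sum_congr rfl fun p hp => ?_
      obtain ⟨hpn, -⟩ := Nat.mem_divisorsAntidiagonal.mp hp
      simp only [hw, hA₁, hB₁, Section8cStatements.arithW, Section8cStatements.diagFac]
      rw [← hpn]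
      ring
  -- Step 3: pointwise inputs on the factorisations `n = dr`
  have hfacts : ∀ {n : ℕ} {p : ℕ × ℕ}, p ∈ Nat.divisorsAntidiagonal n →
      p.1 * p.2 = n ∧ 1 ≤ p.1 ∧ 1 ≤ p.2 ∧ 1 ≤ n := by
    intro n p hp
    obtain ⟨hpn, hn0⟩ := Nat.mem_divisorsAntidiagonal.mp hp
    refine ⟨hpn, Nat.one_le_iff_ne_zero.mpr fun h => hn0 (by rw [← hpn, h, zero_mul]),
      Nat.one_le_iff_ne_zero.mpr fun h => hn0 (by rw [← hpn, h, mul_zero]),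
      Nat.one_le_iff_ne_zero.mpr hn0⟩
  have hA₁p : ∀ {n : ℕ} {p : ℕ × ℕ}, p ∈ Nat.divisorsAntidiagonal n →
      (n : ℝ) < Skeleton.P1 D → ‖A₁ p‖ ≤ σ := by
    intro n p hp hn
    obtain ⟨hpn, -, -, hn1⟩ := hfacts hp
    have hn1R : (1 : ℝ) ≤ n := by exact_mod_cast hn1
    simp only [hA₁]
    rw [hpn]
    exact hAk 6 hlogP1' ((one_le_div (by linarith)).mpr hn.le)
      ((div_le_self hP1pos.le hn1R).trans hP1P.le)
  have hA₂p : ∀ {n : ℕ} {p : ℕ × ℕ}, p ∈ Nat.divisorsAntidiagonal n →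
      (n : ℝ) < Skeleton.P2 D → ‖A₂ p‖ ≤ σ := by
    intro n p hp hn
    obtain ⟨hpn, -, -, hn1⟩ := hfacts hp
    have hn1R : (1 : ℝ) ≤ n := by exact_mod_cast hn1
    simp only [hA₂]
    rw [hpn]
    exact hAk 7 hlogP2 ((one_le_div (by linarith)).mpr hn.le)
      ((div_le_self hP2pos.le hn1R).trans hP2P.le)
  have hB₁p : ∀ {n : ℕ} {p : ℕ × ℕ}, p ∈ Nat.divisorsAntidiagonal n →
      (n : ℝ) < Skeleton.P1 D → ‖B₁ p‖ ≤ σ * ‖PiW χ p.1 p.2‖ := by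
    intro n p hp hn
    obtain ⟨hpn, -, -, hn1⟩ := hfacts hp
    have hn1R : (1 : ℝ) ≤ n := by exact_mod_cast hn1
    simp only [hB₁]
    rw [hpn]
    exact hBk 6 p.1 p.2 hlogP1' ((one_le_div (by linarith)).mpr hn.le)
      ((div_le_self hP1pos.le hn1R).trans hP1P.le)
  have hB₂p : ∀ {n : ℕ} {p : ℕ × ℕ}, p ∈ Nat.divisorsAntidiagonal n →
      (n : ℝ) < Skeleton.P2 D → ‖B₂ p‖ ≤ σ * ‖PiW χ p.1 p.2‖ := by
    intro n p hp hn
    obtain ⟨hpn, -, -, hn1⟩ := hfacts hp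
    have hn1R : (1 : ℝ) ≤ n := by exact_mod_cast hn1
    simp only [hB₂]
    rw [hpn]
    exact hBk 7 p.1 p.2 hlogP2 ((one_le_div (by linarith)).mpr hn.le)
      ((div_le_self hP2pos.le hn1R).trans hP2P.le)
  have hMA₁ : ∀ {n : ℕ} {p : ℕ × ℕ}, p ∈ Nat.divisorsAntidiagonal n →
      (n : ℝ) < Skeleton.P1 D / bigT D → ‖M₁ p - A₁ p‖ ≤ δ := by
    intro n p hp hn
    obtain ⟨hpn, hp1, hp2, -⟩ := hfacts hp
    have hlt : ((p.1 * p.2 : ℕ) : ℝ) < Skeleton.P1 D / bigT D := by rw [hpn]; exact hn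
    simp only [hM₁, hA₁]
    exact h40 p.1 p.2 hp1 hp2 hlt
  have hMA₂ : ∀ {n : ℕ} {p : ℕ × ℕ}, p ∈ Nat.divisorsAntidiagonal n →
      (n : ℝ) < Skeleton.P2 D / bigT D → ‖M₂ p - A₂ p‖ ≤ δ := by
    intro n p hp hn
    obtain ⟨hpn, hp1, hp2, -⟩ := hfacts hp
    have hlt : ((p.1 * p.2 : ℕ) : ℝ) < Skeleton.P2 D / bigT D := by rw [hpn]; exact hn
    simp only [hM₂, hA₂]
    exact h41 p.1 p.2 hp1 hp2 hlt
  have hNB₁ : ∀ {n : ℕ} {p : ℕ × ℕ}, p ∈ Nat.divisorsAntidiagonal n →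
      (n : ℝ) < Skeleton.P1 D / bigT D → ‖N₁ p - B₁ p‖ ≤ δ := by
    intro n p hp hn
    obtain ⟨hpn, hp1, hp2, -⟩ := hfacts hp
    have hlt : ((p.1 * p.2 : ℕ) : ℝ) < Skeleton.P1 D / bigT D := by rw [hpn]; exact hn
    simp only [hN₁, hB₁]
    exact h42 p.1 p.2 hp1 hp2 hlt
  have hNB₂ : ∀ {n : ℕ} {p : ℕ × ℕ}, p ∈ Nat.divisorsAntidiagonal n →
      (n : ℝ) < Skeleton.P2 D / bigT D → ‖N₂ p - B₂ p‖ ≤ δ := by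
    intro n p hp hn
    obtain ⟨hpn, hp1, hp2, -⟩ := hfacts hp
    have hlt : ((p.1 * p.2 : ℕ) : ℝ) < Skeleton.P2 D / bigT D := by rw [hpn]; exact hn
    simp only [hN₂, hB₂]
    exact h43 p.1 p.2 hp1 hp2 hlt
  -- the tail ranges: `x = P_k/n ∈ [1, T]`
  have htail : ∀ {Q : ℝ} {n : ℕ}, 0 < Q → Q / bigT D ≤ n → (n : ℝ) < Q →
      1 ≤ Q / n ∧ Q / n ≤ bigT D ∧ 0 ≤ Real.log (Q / n) ∧ Real.log (Q / n) ≤ τ := by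
    intro Q n hQ hTn hn
    have hnR : (0 : ℝ) < n := lt_of_lt_of_le (div_pos hQ hT0) hTn
    have hx1 : 1 ≤ Q / n := (one_le_div hnR).mpr hn.le
    have hxT : Q / n ≤ bigT D := by
      rw [div_le_iff₀ hnR]
      have := (div_le_iff₀ hT0).mp hTn
      linarith [mul_comm (n : ℝ) (bigT D)]
    refine ⟨hx1, hxT, Real.log_nonneg hx1, ?_⟩
    rw [← hlogT]
    exact Real.log_le_log (by positivity) hxT
  have hMm : ∀ {Q x : ℝ}, ell D ^ 9 / 4 ≤ Real.log Q → 0 ≤ Real.log x → Real.log x ≤ τ →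
      Real.log x / Real.log Q * (1 + Real.log x) ≤ m := by
    intro Q x hℓQ h0 hτ'
    calc Real.log x / Real.log Q * (1 + Real.log x)
        ≤ τ / (ell D ^ 9 / 4) * (2 * τ) :=
          mul_le_mul (div_le_div₀ hτ0.le hτ' (by positivity) hℓQ) (by linarith) (by linarith)
            (div_nonneg hτ0.le (by positivity))
      _ = 8 * τ ^ 2 / ell D ^ 9 := by ring
      _ = m := hm.symm
  have hNν : ∀ {Q x s : ℝ}, ell D ^ 9 / 4 ≤ Real.log Q → 0 ≤ Real.log x → Real.log x ≤ τ →
      0 ≤ s → s ≤ C₂ * ell D * (1 + Real.log x) ^ 3 → Real.log x / Real.log Q * s ≤ ν := by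
    intro Q x s hℓQ h0 hτ' hs0 hs
    have h3 : (1 + Real.log x) ^ 3 ≤ (2 * τ) ^ 3 := pow_le_pow_left₀ (by linarith) (by linarith) 3
    calc Real.log x / Real.log Q * s
        ≤ τ / (ell D ^ 9 / 4) * (C₂ * ell D * (2 * τ) ^ 3) :=
          mul_le_mul (div_le_div₀ hτ0.le hτ' (by positivity) hℓQ)
            (hs.trans (mul_le_mul_of_nonneg_left h3 (mul_nonneg hC₂ hL0.le))) hs0
            (div_nonneg hτ0.le (by positivity))
      _ = 32 * C₂ * τ ^ 4 / ell D ^ 8 := by field_simp; ring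
      _ = ν := hν.symm
  have hM₁m : ∀ {n : ℕ} {p : ℕ × ℕ}, p ∈ Nat.divisorsAntidiagonal n →
      Skeleton.P1 D / bigT D ≤ n → (n : ℝ) < Skeleton.P1 D → ‖M₁ p‖ ≤ m := by
    intro n p hp hTn hn
    obtain ⟨hpn, -, -, hn1⟩ := hfacts hp
    obtain ⟨-, -, h0, hτ'⟩ := htail hP1pos hTn hn
    have h := norm_M1_le c' χ hL2 j (k := p.1 * p.2) (by rw [hpn]; exact hn1) (by rw [hpn]; exact hn)
    have hcast : ((p.1 * p.2 : ℕ) : ℝ) = (n : ℝ) := by rw [hpn]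
    rw [hcast] at h
    simp only [hM₁]
    exact h.trans (hMm hlogP1' h0 hτ')
  have hM₂m : ∀ {n : ℕ} {p : ℕ × ℕ}, p ∈ Nat.divisorsAntidiagonal n →
      Skeleton.P2 D / bigT D ≤ n → (n : ℝ) < Skeleton.P2 D → ‖M₂ p‖ ≤ m := by
    intro n p hp hTn hn
    obtain ⟨hpn, -, -, hn1⟩ := hfacts hp
    obtain ⟨-, -, h0, hτ'⟩ := htail hP2pos hTn hn
    have h := norm_M2_le c' χ hL2 j (k := p.1 * p.2) (by rw [hpn]; exact hn1) (by rw [hpn]; exact hn)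
    have hcast : ((p.1 * p.2 : ℕ) : ℝ) = (n : ℝ) := by rw [hpn]
    rw [hcast] at h
    simp only [hM₂]
    exact h.trans (hMm hlogP2 h0 hτ')
  have hN₁ν : ∀ {n : ℕ} {p : ℕ × ℕ}, p ∈ Nat.divisorsAntidiagonal n →
      Skeleton.P1 D / bigT D ≤ n → (n : ℝ) < Skeleton.P1 D → ‖N₁ p‖ ≤ ν := by
    intro n p hp hTn hn
    obtain ⟨hpn, hp1, hp2, hn1⟩ := hfacts hp
    obtain ⟨hx1, hxT, h0, hτ'⟩ := htail hP1pos hTn hn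
    have hkP : ((p.1 * p.2 : ℕ) : ℝ) < Skeleton.P1 D := by rw [hpn]; exact hn
    have h := norm_N1_le c' χ hL2 j p.1 p.2 (k := p.1 * p.2) (by rw [hpn]; exact hn1) hkP
    have hξ' := hξ p.1 p.2 hp1 hp2 hkP (Skeleton.P1 D / ((p.1 * p.2 : ℕ) : ℝ))
      (by rw [hpn]; exact hx1) (by rw [hpn]; exact hxT)
    have hcast : ((p.1 * p.2 : ℕ) : ℝ) = (n : ℝ) := by rw [hpn]
    rw [hcast] at h hξ'
    simp only [hN₁]
    exact h.trans (hNν hlogP1' h0 hτ' (Finset.sum_nonneg fun _ _ => by positivity) hξ')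
  have hN₂ν : ∀ {n : ℕ} {p : ℕ × ℕ}, p ∈ Nat.divisorsAntidiagonal n →
      Skeleton.P2 D / bigT D ≤ n → (n : ℝ) < Skeleton.P2 D → ‖N₂ p‖ ≤ ν := by
    intro n p hp hTn hn
    obtain ⟨hpn, hp1, hp2, hn1⟩ := hfacts hp
    obtain ⟨hx1, hxT, h0, hτ'⟩ := htail hP2pos hTn hn
    have hkP : ((p.1 * p.2 : ℕ) : ℝ) < Skeleton.P2 D := by rw [hpn]; exact hn
    have hkP1 : ((p.1 * p.2 : ℕ) : ℝ) < Skeleton.P1 D := lt_of_lt_of_le hkP hP2P1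
    have h := norm_N2_le c' χ hL2 j p.1 p.2 (k := p.1 * p.2) (by rw [hpn]; exact hn1) hkP
    have hξ' := hξ p.1 p.2 hp1 hp2 hkP1 (Skeleton.P2 D / ((p.1 * p.2 : ℕ) : ℝ))
      (by rw [hpn]; exact hx1) (by rw [hpn]; exact hxT)
    have hcast : ((p.1 * p.2 : ℕ) : ℝ) = (n : ℝ) := by rw [hpn]
    rw [hcast] at h hξ'
    simp only [hN₂]
    exact h.trans (hNν hlogP2 h0 hτ' (Finset.sum_nonneg fun _ _ => by positivity) hξ')
  -- Step 4: the four range totals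
  have hmem : ∀ {Y Z : ℝ} {n : ℕ}, n ∈ Finset.Ico ⌈Y⌉₊ ⌈Z⌉₊ → Y ≤ n ∧ (n : ℝ) < Z :=
    fun h => ⟨Nat.ceil_le.mp (Finset.mem_Ico.mp h).1, Nat.lt_ceil.mp (Finset.mem_Ico.mp h).2⟩
  have TI : ∑ n ∈ Finset.Ico 1 ⌈Skeleton.P2 D / bigT D⌉₊, ∑ p ∈ Nat.divisorsAntidiagonal n,
      ‖w p‖ * ‖(M₁ p + iota2 * M₂ p) * (N₁ p + conj iota2 * N₂ p) -
        (A₁ p + iota2 * A₂ p) * (B₁ p + conj iota2 * B₂ p)‖ ≤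
      2 * Real.exp 106 * (18 * δ * σ) * (1 + Real.log (Skeleton.P2 D / bigT D)) := by
    have h := range_sum_le c' χ j (Y := 1) (Z := Skeleton.P2 D / bigT D) (E := 18 * δ * σ) le_rfl
      hP2T1 hEI0
      (fun p => (M₁ p + iota2 * M₂ p) * (N₁ p + conj iota2 * N₂ p) -
        (A₁ p + iota2 * A₂ p) * (B₁ p + conj iota2 * B₂ p))
      (fun n hn p hp => by
        have hnlt : (n : ℝ) < Skeleton.P2 D / bigT D := (hmem hn).2
        have h1 : (n : ℝ) < Skeleton.P1 D / bigT D :=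
          lt_of_lt_of_le hnlt (div_le_div_of_nonneg_right hP2P1 hT0.le)
        have h2 : (n : ℝ) < Skeleton.P2 D := lt_of_lt_of_le hnlt hP2TP2
        have h3 : (n : ℝ) < Skeleton.P1 D := lt_of_lt_of_le h2 hP2P1
        exact pointwise_I hι (hMA₁ hp h1) (hMA₂ hp hnlt) (hNB₁ hp h1) (hNB₂ hp hnlt) (hA₁p hp h3)
          (hA₂p hp h2) (hB₁p hp h3) (hB₂p hp h2) (norm_nonneg _) hδσ)
    rw [Nat.ceil_one, div_one] at h
    simpa only [hw] using h
  have TII : ∑ n ∈ Finset.Ico ⌈Skeleton.P2 D / bigT D⌉₊ ⌈Skeleton.P2 D⌉₊,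
      ∑ p ∈ Nat.divisorsAntidiagonal n,
      ‖w p‖ * ‖(M₁ p + iota2 * M₂ p) * (N₁ p + conj iota2 * N₂ p) -
        (A₁ p + iota2 * A₂ p) * (B₁ p + conj iota2 * B₂ p)‖ ≤
      2 * Real.exp 106 * (27 * σ ^ 2 + 12 * σ * ν + 12 * m * σ + 4 * m * ν) *
        (1 + Real.log (Skeleton.P2 D / (Skeleton.P2 D / bigT D))) := by
    have h := range_sum_le c' χ j (Y := Skeleton.P2 D / bigT D) (Z := Skeleton.P2 D)
      (E := 27 * σ ^ 2 + 12 * σ * ν + 12 * m * σ + 4 * m * ν) hP2T1 hP2TP2 hEII0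
      (fun p => (M₁ p + iota2 * M₂ p) * (N₁ p + conj iota2 * N₂ p) -
        (A₁ p + iota2 * A₂ p) * (B₁ p + conj iota2 * B₂ p))
      (fun n hn p hp => by
        obtain ⟨hnT, hn2⟩ := hmem hn
        have h1 : (n : ℝ) < Skeleton.P1 D / bigT D := lt_of_lt_of_le hn2 hP2P1T
        have h3 : (n : ℝ) < Skeleton.P1 D := lt_of_lt_of_le hn2 hP2P1
        exact pointwise_II hι (hMA₁ hp h1) (hNB₁ hp h1) (hM₂m hp hnT hn2) (hN₂ν hp hnT hn2)
          (hA₁p hp h3) (hA₂p hp hn2) (hB₁p hp h3) (hB₂p hp hn2) (norm_nonneg _) hδσ)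
    simpa only [hw] using h
  have TIII : ∑ n ∈ Finset.Ico ⌈Skeleton.P2 D⌉₊ ⌈Skeleton.P1 D / bigT D⌉₊,
      ∑ p ∈ Nat.divisorsAntidiagonal n, ‖w p‖ * ‖M₁ p * N₁ p - A₁ p * B₁ p‖ ≤
      2 * Real.exp 106 * (2 * δ * σ) * (1 + Real.log (Skeleton.P1 D / bigT D / Skeleton.P2 D)) := by
    have h := range_sum_le c' χ j (Y := Skeleton.P2 D) (Z := Skeleton.P1 D / bigT D)
      (E := 2 * δ * σ) hP2one.le hP2P1T hEIII0 (fun p => M₁ p * N₁ p - A₁ p * B₁ p)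
      (fun n hn p hp => by
        obtain ⟨-, hn2⟩ := hmem hn
        have h3 : (n : ℝ) < Skeleton.P1 D := lt_of_lt_of_le hn2 hP1TP1
        exact pointwise_III (hMA₁ hp hn2) (hNB₁ hp hn2) (hA₁p hp h3) (hB₁p hp h3)
          (norm_nonneg _) hδσ)
    simpa only [hw] using h
  have TIV : ∑ n ∈ Finset.Ico ⌈Skeleton.P1 D / bigT D⌉₊ ⌈Skeleton.P1 D⌉₊,
      ∑ p ∈ Nat.divisorsAntidiagonal n, ‖w p‖ * ‖M₁ p * N₁ p - A₁ p * B₁ p‖ ≤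
      2 * Real.exp 106 * (m * ν + σ ^ 2) * (1 + Real.log (Skeleton.P1 D / (Skeleton.P1 D / bigT D))) := by
    have h := range_sum_le c' χ j (Y := Skeleton.P1 D / bigT D) (Z := Skeleton.P1 D)
      (E := m * ν + σ ^ 2) (hP2T1.trans (div_le_div_of_nonneg_right hP2P1 hT0.le)) hP1TP1
      hEIV0 (fun p => M₁ p * N₁ p - A₁ p * B₁ p)
      (fun n hn p hp => by
        obtain ⟨hnT, hn2⟩ := hmem hn
        exact pointwise_IV (hM₁m hp hnT hn2) (hN₁ν hp hnT hn2) (hA₁p hp hn2) (hB₁p hp hn2)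
          (norm_nonneg _))
    simpa only [hw] using h
  -- Step 5: assemble
  have normbound : ∀ (s : Finset ℕ) (F G : ℕ × ℕ → ℂ),
      ‖(∑ n ∈ s, ∑ p ∈ Nat.divisorsAntidiagonal n, w p * F p) -
          ∑ n ∈ s, ∑ p ∈ Nat.divisorsAntidiagonal n, w p * G p‖ ≤
        ∑ n ∈ s, ∑ p ∈ Nat.divisorsAntidiagonal n, ‖w p‖ * ‖F p - G p‖ := by
    intro s F G
    rw [← Finset.sum_sub_distrib]
    refine (norm_sum_le _ _).trans (Finset.sum_le_sum fun n _ => ?_)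
    rw [← Finset.sum_sub_distrib]
    refine (norm_sum_le _ _).trans (Finset.sum_le_sum fun p _ => ?_)
    rw [← mul_sub, norm_mul]
  have h12 := normbound (Finset.Ico 1 ⌈Skeleton.P2 D⌉₊)
    (fun p => (M₁ p + iota2 * M₂ p) * (N₁ p + conj iota2 * N₂ p))
    (fun p => (A₁ p + iota2 * A₂ p) * (B₁ p + conj iota2 * B₂ p))
  have h34 := normbound (Finset.Ico ⌈Skeleton.P2 D⌉₊ ⌈Skeleton.P1 D⌉₊)
    (fun p => M₁ p * N₁ p) (fun p => A₁ p * B₁ p)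
  beta_reduce at h12 h34
  have hc1 : 1 ≤ ⌈Skeleton.P2 D / bigT D⌉₊ :=
    Nat.one_le_iff_ne_zero.mpr (Nat.ceil_pos.mpr (div_pos hP2pos hT0)).ne'
  have hc2 : ⌈Skeleton.P2 D / bigT D⌉₊ ≤ ⌈Skeleton.P2 D⌉₊ := Nat.ceil_mono hP2TP2
  have hc3 : ⌈Skeleton.P2 D⌉₊ ≤ ⌈Skeleton.P1 D / bigT D⌉₊ := Nat.ceil_mono hP2P1T
  have hc4 : ⌈Skeleton.P1 D / bigT D⌉₊ ≤ ⌈Skeleton.P1 D⌉₊ := Nat.ceil_mono hP1TP1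
  -- the logarithms of the range lengths
  have hlogA : Real.log (Skeleton.P2 D / bigT D) ≤ ell D ^ 9 := by
    rw [← hlogP]; exact Real.log_le_log (by positivity) (hP2TP2.trans hP2P.le)
  have hlogB : Real.log (Skeleton.P2 D / (Skeleton.P2 D / bigT D)) = τ := by
    rw [← hlogT]; congr 1; field_simp
  have hlogC : Real.log (Skeleton.P1 D / bigT D / Skeleton.P2 D) ≤ ell D ^ 9 := by
    rw [← hlogP]
    refine Real.log_le_log (by positivity) (le_trans ?_ hP1P.le)
    rw [div_div]
    exact div_le_self hP1pos.le (one_le_mul_of_one_le_of_one_le hT1.le hP2one.le)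
  have hlogD : Real.log (Skeleton.P1 D / (Skeleton.P1 D / bigT D)) = τ := by
    rw [← hlogT]; congr 1; field_simp
  have hL9 : 1 ≤ ell D ^ 9 := one_le_pow₀ hL1
  rw [hSj, hTgt, add_sub_add_comm]
  refine (norm_add_le _ _).trans ((add_le_add h12 h34).trans ?_)
  rw [← Finset.sum_Ico_consecutive _ hc1 hc2, ← Finset.sum_Ico_consecutive _ hc3 hc4]
  refine (add_le_add (add_le_add TI TII) (add_le_add TIII TIV)).trans ?_
  rw [hlogB, hlogD]
  have hJ : 18 * δ * σ * (2 * ell D ^ 9) + (27 * σ ^ 2 + 12 * σ * ν + 12 * m * σ + 4 * m * ν) *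
      (2 * τ) + 2 * δ * σ * (2 * ell D ^ 9) + (m * ν + σ ^ 2) * (2 * τ) ≤
      (40 * C₁ * S + 56 * S ^ 2 + 768 * S * C₂ + 192 * S + 2560 * C₂) * u := by
    linarith [s1, s2, s3, s4, s5]
  calc 2 * Real.exp 106 * (18 * δ * σ) * (1 + Real.log (Skeleton.P2 D / bigT D)) +
        2 * Real.exp 106 * (27 * σ ^ 2 + 12 * σ * ν + 12 * m * σ + 4 * m * ν) * (1 + τ) +
        (2 * Real.exp 106 * (2 * δ * σ) * (1 + Real.log (Skeleton.P1 D / bigT D / Skeleton.P2 D)) +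
          2 * Real.exp 106 * (m * ν + σ ^ 2) * (1 + τ))
      ≤ 2 * Real.exp 106 * (18 * δ * σ) * (2 * ell D ^ 9) +
        2 * Real.exp 106 * (27 * σ ^ 2 + 12 * σ * ν + 12 * m * σ + 4 * m * ν) * (2 * τ) +
        (2 * Real.exp 106 * (2 * δ * σ) * (2 * ell D ^ 9) +
          2 * Real.exp 106 * (m * ν + σ ^ 2) * (2 * τ)) :=
        add_le_add
          (add_le_add (mul_le_mul_of_nonneg_left (by linarith) (mul_nonneg he106 hEI0))
            (mul_le_mul_of_nonneg_left (by linarith) (mul_nonneg he106 hEII0)))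
          (add_le_add (mul_le_mul_of_nonneg_left (by linarith) (mul_nonneg he106 hEIII0))
            (mul_le_mul_of_nonneg_left (by linarith) (mul_nonneg he106 hEIV0)))
    _ = 2 * Real.exp 106 * (18 * δ * σ * (2 * ell D ^ 9) +
        (27 * σ ^ 2 + 12 * σ * ν + 12 * m * σ + 4 * m * ν) * (2 * τ) +
        2 * δ * σ * (2 * ell D ^ 9) + (m * ν + σ ^ 2) * (2 * τ)) := by ring
    _ ≤ 2 * Real.exp 106 * ((40 * C₁ * S + 56 * S ^ 2 + 768 * S * C₂ + 192 * S + 2560 * C₂) * u) :=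
        mul_le_mul_of_nonneg_left hJ (by positivity)
    _ = Real.exp 106 * (80 * C₁ * S + 112 * S ^ 2 + 1536 * S * C₂ + 384 * S + 5120 * C₂) * u := by
        ring

/-! ## `Z22:§8.u044`: the deduction holds -/

/-- **`Z22:§8.u044` DISCHARGED as a deduction** (`Section8cStatements.DedStep8u044 c′`, every real
`c′`): the four applications `§8.u040`–`u043` of Lemmas 8.2/8.4 imply the gathering display
"`S_j(𝐚₁₁,𝐚₂₁) = L′(1,χ)²Σ_{dr<P₂}(…) + L′(1,χ)²Σ_{P₂≤dr<P₁}(…) + o(α)`" — the manuscript's "by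
simple approximation", with the tail ranges `P_k/T ≤ dr < P_k` controlled by
`XiZeroMajorant.xiZeroTailMean` (GAP row G-d20-1's WANTED estimate, proved in the tree).
[cite: Zhang2022LandauSiegel, §8 display before (8.10) p.47, tex L2436] -/
theorem dedStep8u044_holds (c' : ℝ) : Section8cStatements.DedStep8u044 c' := by
  intro h40 h41 h42 h43 ε hε
  obtain ⟨C40, D40, h40⟩ := h40
  obtain ⟨C41, D41, h41⟩ := h41
  obtain ⟨C42, D42, h42⟩ := h42
  obtain ⟨C43, D43, h43⟩ := h43
  obtain ⟨Cξ, Dξ, hξ⟩ := XiZeroMajorant.xiZeroTailMean c'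
  set C₁ : ℝ := max (max |C40| |C41|) (max |C42| |C43|) with hC₁def
  have h40le : |C40| ≤ C₁ := le_trans (le_max_left _ _) (le_max_left _ _)
  have h41le : |C41| ≤ C₁ := le_trans (le_max_right _ _) (le_max_left _ _)
  have h42le : |C42| ≤ C₁ := le_trans (le_max_left _ _) (le_max_right _ _)
  have h43le : |C43| ≤ C₁ := le_trans (le_max_right _ _) (le_max_right _ _)
  have hC₁ : 0 ≤ C₁ := (abs_nonneg C40).trans h40le
  set C₂ : ℝ := max Cξ 0 with hC₂def
  have hC₂ : 0 ≤ C₂ := le_max_right _ _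
  obtain ⟨K, hK0, hcore⟩ := core c' hC₁ hC₂
  set Dfin : ℕ := ⌈Real.exp (K ^ 10 / (ε * π) ^ 10)⌉₊ with hDfin
  refine ⟨max (max (max D40 D41) (max D42 D43)) (max Dξ (max ⌈Real.exp 3⌉₊ Dfin)),
    fun D _ χ hD hq hp hA j hj => ?_⟩
  have hD40 : D40 ≤ D := le_trans (le_trans (le_max_left _ _) (le_max_left _ _)) (le_trans (le_max_left _ _) hD)
  have hD41 : D41 ≤ D := le_trans (le_trans (le_max_right _ _) (le_max_left _ _)) (le_trans (le_max_left _ _) hD)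
  have hD42 : D42 ≤ D := le_trans (le_trans (le_max_left _ _) (le_max_right _ _)) (le_trans (le_max_left _ _) hD)
  have hD43 : D43 ≤ D := le_trans (le_trans (le_max_right _ _) (le_max_right _ _)) (le_trans (le_max_left _ _) hD)
  have hDξ : Dξ ≤ D := le_trans (le_max_left _ _) (le_trans (le_max_right _ _) hD)
  have hD3 : ⌈Real.exp 3⌉₊ ≤ D :=
    le_trans (le_trans (le_max_left _ _) (le_max_right _ _)) (le_trans (le_max_right _ _) hD)
  have hDf : Dfin ≤ D :=
    le_trans (le_trans (le_max_right _ _) (le_max_right _ _)) (le_trans (le_max_right _ _) hD)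
  have hL3 : 3 ≤ ell D := three_le_ell hD3
  have hL1 : 1 ≤ ell D := by linarith
  have hL0 : 0 < ell D := by linarith
  have hinv : ∀ {C : ℝ}, |C| ≤ C₁ → C * (ell D ^ 15)⁻¹ ≤ C₁ / ell D ^ 15 := by
    intro C hC
    rw [div_eq_mul_inv]
    exact mul_le_mul_of_nonneg_right ((le_abs_self C).trans hC) (by positivity)
  have key := hcore hq hp hD3 j
    (fun d r hd hr hdr => (h40 D χ hD40 hq hp hA j hj d r hd hr hdr).trans (hinv h40le))
    (fun d r hd hr hdr => (h41 D χ hD41 hq hp hA j hj d r hd hr hdr).trans (hinv h41le))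
    (fun d r hd hr hdr => (h42 D χ hD42 hq hp hA j hj d r hd hr hdr).trans (hinv h42le))
    (fun d r hd hr hdr => (h43 D χ hD43 hq hp hA j hj d r hd hr hdr).trans (hinv h43le))
    (fun d r hd hr hdr x hx1 hxT =>
      (hξ D χ hDξ hq hp j hj d r hd hr hdr x hx1 hxT).trans
        (mul_le_mul_of_nonneg_right (mul_le_mul_of_nonneg_right (le_max_left _ _) hL0.le)
          (pow_nonneg (by linarith [Real.log_nonneg hx1]) 3)))
  have hLK : K ^ 10 / (ε * π) ^ 10 ≤ ell D := by
    have hexp : Real.exp (K ^ 10 / (ε * π) ^ 10) ≤ D :=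
      le_trans (Nat.le_ceil _) (by exact_mod_cast hDf)
    exact (Real.le_log_iff_exp_le (lt_of_lt_of_le (Real.exp_pos _) hexp)).mpr hexp
  calc _ ≤ K * (ell D ^ (1.1 : ℝ)) ^ 7 / ell D ^ 17 := key
    _ ≤ ε * π / ell D ^ 9 := final_small (by positivity) hL1 hLK
    _ = ε * alpha D := by rw [Section2.alpha_eq_pi_div_ell9]; ring

variable (c' : ℝ) in
/-- `DedStep8u044` — `_holds` alias of `dedStep8u044_holds` above under the fact's exact name, stated under the
prover's own binders as section variables (appended 2026-08-28, D-0026 bookkeeping: the proof term is the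
existing theorem of this file; no statement, definition or attribute is edited; no new named fact; the
ledger's debt table listed the fact unproved). [cite: Zhang2022LandauSiegel, §8 display before (8.10) p.47, tex L2436] -/
theorem _root_.Literature.NumberTheory.LFunctions.Zhang2022.Section8cStatements.DedStep8u044_holds :
    _root_.Literature.NumberTheory.LFunctions.Zhang2022.Section8cStatements.DedStep8u044 c' :=
  _root_.Literature.NumberTheory.LFunctions.Zhang2022.Section8FrontEnd44Reduction.dedStep8u044_holds (c' := c')

/-! ## Consequence: the banked deduction node `Skeleton.Ded823 c′` holds (`c′ ≥ 0`) -/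

/-- **`Skeleton.Ded823 c′` HOLDS for every `c′ ≥ 0`** (the banked deduction node of (8.23),
`Eq87 → Prop71 → Lemma82 → Lemma83 → Lemma84 → Eval823`, DISCHARGE board row D01): seat d29's
closer `Section8Ded823.ded823_of_u044` (`u040/u041` from `Section8FrontEnd82`, `u042/u043` from the
antecedent `Lemma84` via `Section8FrontEnd84`, then (8.10), `§8.u046`, (8.11), (8.12), `§8.u055`,
`§8.u056`, (8.23) — all kernel theorems) applied to `dedStep8u044_holds`.
[cite: Zhang2022LandauSiegel, §8 (8.9)–(8.23) pp.46–50] -/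
theorem ded823_holds {c' : ℝ} (hc' : 0 ≤ c') : Ded823 c' :=
  Section8Ded823.ded823_of_u044 c' hc' (dedStep8u044_holds c')

end Literature.NumberTheory.LFunctions.Zhang2022.Section8FrontEnd44Reduction
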